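import Summits.QuantumFields.YangMills.Theorems.UnitScaleTiltFluctuationComparisonRegPrGlobalSlackKernelEndToEnd
import HarnessLib

/-!
# `Sketch_ideator1_g14` — F-idea1-g14-1: THE COLLAR POLYLOGARITHM `r(g) = (1 + log g⁻¹)^{r₀}` OF (28) IS PAID BY THE KERNEL'S OWN BIRTH COUPLING
# (crux-ideate seat ym-cruxidea-19201-1, generation 14; crux `FluctuationComparisonRegPr` stmt-QuantumFields-19201 (aside), lane served:
# `FluctuationComparisonRegPrL` stmt-QuantumFields-19935, STUB 3⁗ `stub_globalTwoRunSlackFam`, skeleton of record `Lines/birth_v5j3.lean`)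

TRIGGER.  ym-ust-19935-slack g0, `REPORT-K1a-display-g0.md` (sha16 dda047feb06fc157), LOCATED MISMATCH: the displayed configuration row of the tree,
`bound28 : ‖(𝔖 k).Bcfg Y h U‖ ≤ cB·(r(g_k)·g_k·p(g_k))` ([Balaban1985UV3] (28) p. 263 with the collar `R(g) = R₁ r(g)` of (7) p. 257 / (39) p. 266),
carries the polylogarithm `rFun r₀ g = (1 + log g⁻¹)^{r₀}`, whereas the K1a interface row of record `CfgSizeΦ D B b₀ p₀ C_s` (tree
`…GlobalSlackKernelMatching`, §2) is `C_s·θ(n)·x²` with `θ(n) = g_n p(g_n)` and NO `r`-factor; `K`-uniformly the two agree only for `r₀ = 0`.  The slack pen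
proposed a profile letter `C_c g^{1-c}` (a re-typing of the slack letter of `GlobalSupRateTSlack`, hence of 3⁗ — a registry event) and asked for an «r₀ letter».

FINDING (F-idea1-g14-1): NO LETTER IS NEEDED.  The polylogarithm sits on the CONFIGURATION, the chart carries the birth coupling `g_b = √(γL^{-(K-b)})` (= run `K`'s `S.gk b`, the displayed `chart` row G3D-01) in its
sup bound (`chart : ChartAnalyticityAsCited (Ψ Y) ρ (C25·g_k·e^{−κ dj Y})`, [Balaban1985UV3] Prop. 3 (34) p. 264), and `jet26` is homogeneous of degrees
2…6: RESCALE the pair `(Φ, B)` by the collar weight `λ_{K,b} := r(g_b) ≥ 1` of the chart's own birth coupling,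
`Φ̃ K b Y z := Φ K b Y (λ • z)`, `B̃ K k b Y W := λ⁻¹ • B K k b Y W`.  Then
* `jet26 (Φ̃ K b Y) (B̃ …) = jet26 (Φ K b Y) (B …)` — `TaylorSplitΦ PT Φ̃ e B̃ R` holds with the SAME `PT, e, R` (`taylorSplitΦ_rescale`);
* the HONEST configuration rows (with `r`) `CfgSizeΦr`, `CfgCauchyΦr` become the rows OF RECORD `CfgSizeΦ`, `CfgCauchyΦ` for `B̃` with the SAME constants;
* `ker Φ̃ K b Y d = λ^d • ker Φ K b Y d`, `kerT Φ̃ K b Y d = λ^d • kerT Φ K b Y d` (matched charts `(K,b)`/`(K+1,b+1)` have the same birth height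
  `K-b = (K+1)-(b+1)`), and `λ^d g_b ≤ g_b (1 + log g_b⁻¹)^{6r₀} ≤ M(6r₀, 1)` (`logPowConst`; the tangent-line bound `B10.rpow_mul_exp_neg_le` of the
  tree): the honest `g`-carrying kernel size row `KernelSizeΦg` becomes `KernelSizeΦ D Φ̃ κ (C_E·M(6r₀,1))`;
* K1a itself: the `g`-carrying form `FlatKernelCauchyΦg` (‖kerT − ker‖ ≤ C·g_b·e^{−κ𝓛}·x_b^a, the natural reading of [King1986] Prop. 3.6 (3.56) p. 662, whose
  kernels are activities of size `O(g)`) gives `FlatKernelCauchyΦ D Φ̃ κ a (C·M(6r₀,1))` with NO rate loss; the VERBATIM row of record `FlatKernelCauchyΦ D Φ κ a C`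
  (no `g`) still suffices by interpolation with `KernelSizeΦg`: `min(A, B) ≤ A^{1-t}B^t` gives `FlatKernelCauchyΦ D Φ̃ κ (a(1-t)) (C^{1-t}(2C_E)^t·M(6r₀,t))`
  for any `0 < t ≤ 1` — the rate `a` of 3⁗ is an ∃-bound, so `a(1-t)` costs nothing;
* `RemainderSmallΦ D R b₀ p₀ κ C_R` is untouched (same `R`).
Hence the LANDED composition `polymerCauchyMinAtTSlack_of_charts` applies BY NAME to `(Φ̃, B̃)`: `polymerCauchyMinAtTSlack_of_honest_charts_g` (lossless) and
`polymerCauchyMinAtTSlack_of_honest_charts` (verbatim K1a row, rate `a(1-t)`), both concluding `PolymerCauchyMinAtTSlack D PT b₀ p₀ κ _ 7 _` — σ = 7, profile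
`θBal(b₀,p₀)` = the window profile, 3⁗ TEXT UNCHANGED, no (α)-letter, no β-door, no registry event.  What this is NOT: not a proof of K1a; not a change of any
row of record (the honest rows are INPUT-side lettered variants the display audit located; the rows of record are their images under the rescaling).
STEP (iii) AND THE END-TO-END LINE IN HONEST CURRENCY (§5–§6, composing BY NAME with the slack pen's landed `…GlobalSlackKernelCauchyEstimates` p531504 and
`…GlobalSlackKernelEndToEnd` p532839).  Its `ChartAnalyticΦ` gives the coupling away («with `g_k ≤ 1` given away»); its keep-`g` rider `ChartAnalyticGΦ D Φ κ ρ C_A g` keeps it,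
and at the BIRTH-COUPLING PROFILE `gCoFam F γ K b := g_{K-b}` = run `K`'s displayed `S.gk b` (matched charts share it): (a) `ChartAnalyticGΦ … (gCoFam F γ) ⟹ KernelSizeΦg D Φ κ (C_A·(max 1 (12/ρ))⁶)`
(BOTH runs: its `norm_iteratedFDeriv_zero_le_uniform` by name + `‖kerT‖ ≤ ‖ker_{K+1}‖` from `‖transport‖ ≤ 1`); (b) the HONEST Taylor rest: `ChartAnalyticGΦ … (gCoFam F γ)` +
`Deriv1VanishΦ` + `CfgSizeΦr` + the `K`-UNIFORM honest window `C_s·M(r₀,1)·λ_{n+1} θ(n) ≤ ρ/4` (all `n`; `λ_{n+1}` = the birth step's `rFun r₀ (S.gk k)` of `bound28` at lattice level `k+1 = K-n`; `λ_{n+1} θ(n) ≲ b₀ g_n (1+log g_{n+1}⁻¹)^{p₀+r₀} → 0` as `γ → 0` — the same «γ small»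
type as the window of record `C_s θ(n) ≤ ρ/4`) `⟹ RemainderSmallΦ D (taylorRest Φ B) b₀ p₀ κ (2C_A(2C_s/ρ)⁷·M(7r₀,1))`: the radius is the honest size `s = λ_{K-j}·C_s θ(n) x²`,
made `K`-uniform by the splitting `λ_{n+1+m} ≤ λ_{n+1}·(1 + log x⁻¹)^{r₀}` (`x = L^{-m}`, `collarW_add_le`) and `x(1+log x⁻¹)^{r₀} ≤ M(r₀,1)`, and the seventh power of the collar is
paid by the chart's coupling, `λ⁷ g_b ≤ M(7r₀,1)` — so `polymerCauchyMinAtTSlack_of_displayed_honest[_g]`: ALL SIX INPUT ROWS IN THE DISPLAYED (honest, `r`- and `g`-carrying)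
CURRENCY ⟹ the local slack row at σ = 7 for the canonical `termOfCharts Φ B Rfar`.  (c) §6: `K1aLineHonest L 𝔠 a₀ a₁ a` := the slack pen's `K1aLine` with exactly the three
display-located rows replaced by their honest forms (`KernelSizeΦg`; `CfgSizeΦr`/`CfgCauchyΦr` at the record's `𝔠.r₀`), everything else verbatim; **`k1aLine_of_honest :
K1aLineHonest L 𝔠 a₀ a₁ a → K1aLine L 𝔠 a₀ a₁ (a(1-t))`** (witness: the rescaled pair) and **`globalTwoRunSlackFam_of_k1aLineHonest`** = `globalTwoRunSlackFam_of_k1aLine ∘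
k1aLine_of_honest (t = ½)`: ⟨THE REGISTERED TEXT OF 3⁗ VERBATIM⟩ from the HONEST line — the owner's depmap of record (SWEEP 5) composed with one rescaling, nothing re-typed.
FOR THE OWNER / SLACK PEN (stated, not decided): read (28) as `CfgSizeΦr` and (34)/G3D-01 with the coupling (`KernelSizeΦg` ⇐ `ChartAnalyticGΦ … (gCoFam F γ)`), i.e. discharge
`K1aLineHonest`'s rows for the lane's families; `K1aLine` then follows by `k1aLine_of_honest` — no «r₀ letter», no profile letter `C_c g^{1-c}`, no β-door, 3⁗ text unchanged.
Sources: [Balaban1985UV3] (7) p.257, (28) p.263, (34) p.264, (39) p.266; [King1986] Prop. 3.6 (3.55)-(3.56) p.662, Prop. 3.9 (3.71)-(3.74) p.665.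
-/

noncomputable section

open scoped BigOperators
open Literature.MathematicalPhysics.QuantumFieldTheory.Balaban1983to89
open Literature.MathematicalPhysics.QuantumFieldTheory.Balaban1983to89.T3ContinuumYM3Torus
open Literature.MathematicalPhysics.QuantumFieldTheory.Balaban1983to89.T3UnitScaleTilt
open Literature.MathematicalPhysics.QuantumFieldTheory.Balaban1983to89.T3LevelShift
open Literature.MathematicalPhysics.QuantumFieldTheory.Balaban1983to89.T3AlphaInputsAC
open Literature.MathematicalPhysics.QuantumFieldTheory.Balaban1983to89.T3AlphaPolymerSocket
open Literature.MathematicalPhysics.QuantumFieldTheory.Balaban1983to89.T3AlphaInputsACTwoRun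
open Literature.MathematicalPhysics.QuantumFieldTheory.Balaban1983to89.T3AlphaInputsACTwoRunLevel
open Literature.MathematicalPhysics.QuantumFieldTheory.Balaban1985CMP102.Binders (ChartAnalyticityAsCited)
open Summit.QuantumFields.Balaban3D.Carriers
open Summit.QuantumFields.Balaban3D.Proofs.Primitives
open Summit.QuantumFields.Balaban3D.Proofs.GroupModelLieC (lieC)
open Summit.QuantumFields.YangMills.Theorems
open Summit.QuantumFields.YangMills.Theorems.GlobalSlack (GlobalSupRateTSlack)
open Summit.QuantumFields.Balaban3D.Proofs.Representation33 (jet26)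
open Summit.QuantumFields.YangMills.Theorems.GlobalSlackKernelMatching

namespace Summit.QuantumFields.YangMills.Cruxes.FluctuationComparisonRegPr.Ideate1CollarPolylog

/-! ## §0 Scalar lemmas: the coupling pays any polylogarithm; two-point interpolation -/

/-- `M(q, c) := ((q+1)/c)^{q+1} e^{c-(q+1)}` — a bound for `g^c (1 + log g⁻¹)^q` on `(0, 1]` (`q ≥ 0`, `c > 0`). [folklore] -/
def logPowConst (q c : ℝ) : ℝ := ((q + 1) / c) ^ (q + 1) * Real.exp (c - (q + 1))

/-- `0 < M(q, c)`. [folklore] -/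
theorem logPowConst_pos {q c : ℝ} (hq : 0 ≤ q) (hc : 0 < c) : 0 < logPowConst q c := by
  unfold logPowConst
  have h : 0 < (q + 1) / c := div_pos (by linarith) hc
  exact mul_pos (Real.rpow_pos_of_pos h _) (Real.exp_pos _)

/-- **`g^c (1 + log g⁻¹)^q ≤ M(q, c)` on `(0, 1]`** (`q ≥ 0`, `c > 0`): the tree's tangent-line bound `B10.rpow_mul_exp_neg_le` at exponent `q + 1`.
[cite: Balaban1985UV3, (7) p.257] -/
theorem rpow_mul_logpow_le {g q c : ℝ} (hg : 0 < g) (hg1 : g ≤ 1) (hq : 0 ≤ q) (hc : 0 < c) :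
    g ^ c * (1 + Real.log g⁻¹) ^ q ≤ logPowConst q c := by
  have hu := B10.log_inv_nonneg_of_le_one hg hg1
  have hgc : g ^ c = Real.exp (-(c * Real.log g⁻¹)) := by
    rw [Real.rpow_def_of_pos hg, Real.log_inv]
    congr 1
    ring
  have h1 : (1 + Real.log g⁻¹) ^ q ≤ (1 + Real.log g⁻¹) ^ (q + 1) :=
    Real.rpow_le_rpow_of_exponent_le (by linarith) (by linarith)
  have hcore := B10.rpow_mul_exp_neg_le (q + 1) c (Real.log g⁻¹) (by linarith) hc (by linarith)
  calc g ^ c * (1 + Real.log g⁻¹) ^ q = (1 + Real.log g⁻¹) ^ q * Real.exp (-(c * Real.log g⁻¹)) := by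
        rw [hgc, mul_comm]
    _ ≤ (1 + Real.log g⁻¹) ^ (q + 1) * Real.exp (-(c * Real.log g⁻¹)) :=
        mul_le_mul_of_nonneg_right h1 (Real.exp_pos _).le
    _ ≤ logPowConst q c := hcore

/-- `g (1 + log g⁻¹)^q ≤ M(q, 1)` on `(0, 1]`. [cite: Balaban1985UV3, (7) p.257] -/
theorem mul_logpow_le {g q : ℝ} (hg : 0 < g) (hg1 : g ≤ 1) (hq : 0 ≤ q) :
    g * (1 + Real.log g⁻¹) ^ q ≤ logPowConst q 1 := by
  simpa only [Real.rpow_one] using rpow_mul_logpow_le hg hg1 hq one_pos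

/-- Two-point interpolation: `min(A, B) ≤ A^{1-t} B^t` for `A, B ≥ 0`, `0 ≤ t ≤ 1`. [folklore] -/
theorem min_le_rpow_mul_rpow {A B t : ℝ} (hA : 0 ≤ A) (hB : 0 ≤ B) (ht0 : 0 ≤ t) (ht1 : t ≤ 1) :
    min A B ≤ A ^ (1 - t) * B ^ t := by
  have h1 : (1 - t) + t ≠ 0 := by norm_num
  rcases le_total A B with hAB | hBA
  · rw [min_eq_left hAB]
    calc A = A ^ (1 - t) * A ^ t := by rw [← Real.rpow_add' hA h1, sub_add_cancel, Real.rpow_one]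
      _ ≤ A ^ (1 - t) * B ^ t := mul_le_mul_of_nonneg_left (Real.rpow_le_rpow hA hAB ht0) (Real.rpow_nonneg hA _)
  · rw [min_eq_right hBA]
    calc B = B ^ (1 - t) * B ^ t := by rw [← Real.rpow_add' hB h1, sub_add_cancel, Real.rpow_one]
      _ ≤ A ^ (1 - t) * B ^ t :=
          mul_le_mul_of_nonneg_right (Real.rpow_le_rpow hB hBA (by linarith)) (Real.rpow_nonneg hB _)

/-! ## §1 The birth coupling `g_i` and the collar weight `λ_i = r(g_i)` -/

section Coupling

variable {L : ℕ} {γ r₀ : ℝ}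

/-- `g_i = √(γ L^{-i})`, the effective coupling at distance `i` from the unit scale (the `g` inside `θBal … i`). [cite: Balaban1985UV3, (5) p.256] -/
def gCo (L : ℕ) (γ : ℝ) (i : ℕ) : ℝ := Real.sqrt (γ * ((L : ℝ)⁻¹) ^ i)

/-- `0 < g_i`. [folklore] -/
theorem gCo_pos (hL : 1 ≤ L) (hγ : 0 < γ) (i : ℕ) : 0 < gCo L γ i := by
  unfold gCo
  have hL' : (0 : ℝ) < L := by exact_mod_cast hL
  exact Real.sqrt_pos.mpr (mul_pos hγ (pow_pos (inv_pos.mpr hL') i))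

/-- `g_i ≤ 1` (`0 < γ ≤ 1`, `L ≥ 1`). [cite: Balaban1985UV3, (5) p.256] -/
theorem gCo_le_one (hL : 1 ≤ L) (hγ : 0 < γ) (hγ1 : γ ≤ 1) (i : ℕ) : gCo L γ i ≤ 1 :=
  T3Thresholds.coupling_le_one hL hγ hγ1 i

/-- The COLLAR WEIGHT `λ_i := r(g_i) = (1 + log g_i⁻¹)^{r₀}` ((7) p. 257, (39) p. 266). [cite: Balaban1985UV3, (7) p.257] -/
def collarW (L : ℕ) (γ r₀ : ℝ) (i : ℕ) : ℝ := B10.rFun r₀ (gCo L γ i)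

/-- `1 ≤ λ_i` (`r₀ ≥ 0`). [folklore] -/
theorem one_le_collarW (hL : 1 ≤ L) (hγ : 0 < γ) (hγ1 : γ ≤ 1) (hr : 0 ≤ r₀) (i : ℕ) : 1 ≤ collarW L γ r₀ i := by
  have hu := B10.log_inv_nonneg_of_le_one (gCo_pos hL hγ i) (gCo_le_one hL hγ hγ1 i)
  unfold collarW B10.rFun
  exact Real.one_le_rpow (by linarith) hr

/-- `0 < λ_i`. [folklore] -/
theorem collarW_pos (hL : 1 ≤ L) (hγ : 0 < γ) (hγ1 : γ ≤ 1) (hr : 0 ≤ r₀) (i : ℕ) : 0 < collarW L γ r₀ i :=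
  lt_of_lt_of_le one_pos (one_le_collarW hL hγ hγ1 hr i)

/-- `λ_i^d ≤ (1 + log g_i⁻¹)^{6r₀}` for `d ≤ 6`. [folklore] -/
theorem collarW_pow_le (hL : 1 ≤ L) (hγ : 0 < γ) (hγ1 : γ ≤ 1) (hr : 0 ≤ r₀) {d : ℕ} (hd : d ≤ 6) (i : ℕ) :
    collarW L γ r₀ i ^ d ≤ (1 + Real.log (gCo L γ i)⁻¹) ^ (6 * r₀) := by
  have hu := B10.log_inv_nonneg_of_le_one (gCo_pos hL hγ i) (gCo_le_one hL hγ hγ1 i)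
  have hd' : (d : ℝ) ≤ 6 := by exact_mod_cast hd
  unfold collarW B10.rFun
  rw [← Real.rpow_natCast, ← Real.rpow_mul (by linarith)]
  exact Real.rpow_le_rpow_of_exponent_le (by linarith) (by nlinarith)

/-- **The coupling pays the collar**: `λ_i^d · g_i ≤ M(6r₀, 1)` for `d ≤ 6`. [cite: Balaban1985UV3, (7) p.257] -/
theorem collarW_pow_mul_gCo_le (hL : 1 ≤ L) (hγ : 0 < γ) (hγ1 : γ ≤ 1) (hr : 0 ≤ r₀) {d : ℕ} (hd : d ≤ 6) (i : ℕ) :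
    collarW L γ r₀ i ^ d * gCo L γ i ≤ logPowConst (6 * r₀) 1 := by
  have hg := gCo_pos hL hγ i
  have hg1 := gCo_le_one hL hγ hγ1 i
  calc collarW L γ r₀ i ^ d * gCo L γ i ≤ (1 + Real.log (gCo L γ i)⁻¹) ^ (6 * r₀) * gCo L γ i :=
        mul_le_mul_of_nonneg_right (collarW_pow_le hL hγ hγ1 hr hd i) hg.le
    _ = gCo L γ i * (1 + Real.log (gCo L γ i)⁻¹) ^ (6 * r₀) := mul_comm _ _
    _ ≤ logPowConst (6 * r₀) 1 := mul_logpow_le hg hg1 (by nlinarith)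

/-- **A fractional power of the coupling pays the collar**: `λ_i^d · g_i^t ≤ M(6r₀, t)` for `d ≤ 6`, `t > 0`. [cite: Balaban1985UV3, (7) p.257] -/
theorem collarW_pow_mul_gCo_rpow_le (hL : 1 ≤ L) (hγ : 0 < γ) (hγ1 : γ ≤ 1) (hr : 0 ≤ r₀) {d : ℕ} (hd : d ≤ 6) (i : ℕ)
    {t : ℝ} (ht : 0 < t) : collarW L γ r₀ i ^ d * gCo L γ i ^ t ≤ logPowConst (6 * r₀) t := by
  have hg := gCo_pos hL hγ i
  have hg1 := gCo_le_one hL hγ hγ1 i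
  calc collarW L γ r₀ i ^ d * gCo L γ i ^ t ≤ (1 + Real.log (gCo L γ i)⁻¹) ^ (6 * r₀) * gCo L γ i ^ t :=
        mul_le_mul_of_nonneg_right (collarW_pow_le hL hγ hγ1 hr hd i) (Real.rpow_nonneg hg.le _)
    _ = gCo L γ i ^ t * (1 + Real.log (gCo L γ i)⁻¹) ^ (6 * r₀) := mul_comm _ _
    _ ≤ logPowConst (6 * r₀) t := rpow_mul_logpow_le hg hg1 (by nlinarith) ht

end Coupling

/-! ## §2 Dilations and the jet: generic calculus -/

section Dilation

variable {E G : Type*} [NormedAddCommGroup E] [NormedSpace ℂ E] [NormedAddCommGroup G] [NormedSpace ℂ G]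

variable (E) in
/-- The dilation `z ↦ c • z` (`c ≠ 0`) as a continuous linear automorphism. [folklore] -/
def dilateEquiv (c : ℂ) (hc : c ≠ 0) : E ≃L[ℂ] E :=
  ContinuousLinearEquiv.equivOfInverse (c • ContinuousLinearMap.id ℂ E) (c⁻¹ • ContinuousLinearMap.id ℂ E)
    (fun z => show c⁻¹ • (c • z) = z from inv_smul_smul₀ hc z)
    (fun z => show c • (c⁻¹ • z) = z from smul_inv_smul₀ hc z)

theorem dilateEquiv_apply {c : ℂ} (hc : c ≠ 0) (z : E) : dilateEquiv E c hc z = c • z := rfl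

theorem coe_dilateEquiv {c : ℂ} (hc : c ≠ 0) : (dilateEquiv E c hc : E →L[ℂ] E) = c • ContinuousLinearMap.id ℂ E := by
  ext z
  rfl

/-- **Chain rule for a dilation, all orders, no differentiability hypothesis**: `Dⁿ(f ∘ (c•))(x) = Dⁿf(c•x) ∘ (c•id)^{⊗n}`
(`ContinuousLinearEquiv.iteratedFDerivWithin_comp_right` on `univ`). [folklore] -/
theorem iteratedFDeriv_comp_smul (f : E → G) {c : ℂ} (hc : c ≠ 0) (x : E) (n : ℕ) :
    iteratedFDeriv ℂ n (fun z => f (c • z)) x =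
      (iteratedFDeriv ℂ n f (c • x)).compContinuousLinearMap fun _ => c • ContinuousLinearMap.id ℂ E := by
  have h := (dilateEquiv E c hc).iteratedFDerivWithin_comp_right f uniqueDiffOn_univ (Set.mem_univ (dilateEquiv E c hc x)) n
  rw [Set.preimage_univ, iteratedFDerivWithin_univ, iteratedFDerivWithin_univ, coe_dilateEquiv] at h
  simp only [Function.comp_def, dilateEquiv_apply] at h
  exact h

/-- Pre-composition of an `n`-linear map with `c • id` in every slot is multiplication by `cⁿ`. [folklore] -/
theorem compContinuousLinearMap_smul_id {n : ℕ} (M : ContinuousMultilinearMap ℂ (fun _ : Fin n => E) G) (c : ℂ) :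
    (M.compContinuousLinearMap fun _ => c • ContinuousLinearMap.id ℂ E) = c ^ n • M := by
  ext v
  simp only [ContinuousMultilinearMap.compContinuousLinearMap_apply, FunLike.coe_smul, Pi.smul_apply,
    ContinuousLinearMap.id_apply]
  rw [show (fun i => c • v i) = fun i => (fun _ : Fin n => c) i • v i from rfl, ContinuousMultilinearMap.map_smul_univ,
    Fin.prod_const]

/-- `Dⁿ(f ∘ (c•))(0) = cⁿ • Dⁿf(0)`. [folklore] -/
theorem iteratedFDeriv_comp_smul_zero (f : E → G) {c : ℂ} (hc : c ≠ 0) (n : ℕ) :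
    iteratedFDeriv ℂ n (fun z => f (c • z)) 0 = c ^ n • iteratedFDeriv ℂ n f 0 := by
  rw [iteratedFDeriv_comp_smul f hc 0 n, smul_zero, compContinuousLinearMap_smul_id]

/-- **The jet is dilation-invariant**: `jet26 (f ∘ (c•)) (c⁻¹ • B) = jet26 f B` (`c ≠ 0`; orders 2…6 are homogeneous). [cite: Balaban1985UV3, (30) p.263] -/
theorem jet26_comp_smul (f : E → G) {c : ℂ} (hc : c ≠ 0) (B : E) :
    jet26 (fun z => f (c • z)) (c⁻¹ • B) = jet26 f B := by
  unfold jet26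
  refine Finset.sum_congr rfl fun n _ => ?_
  rw [iteratedFDeriv_comp_smul_zero f hc n, smul_apply]
  congr 1
  rw [show (fun _ : Fin n => c⁻¹ • B) = fun i => (fun _ : Fin n => c⁻¹) i • (fun _ : Fin n => B) i from rfl,
    ContinuousMultilinearMap.map_smul_univ, Fin.prod_const, smul_smul, ← mul_pow, mul_inv_cancel₀ hc, one_pow, one_smul]

end Dilation

/-! ## §3 The honest (lettered) rows the display audit located, and the rescaled pair -/

section Rows

variable {𝕍 : Type} [NormedAddCommGroup 𝕍] [NormedSpace ℂ 𝕍] {F : T3Family} {γ : ℝ}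

/-- **KERNEL SIZE ROW WITH THE BIRTH COUPLING** (both runs, run-`K` tree length): `‖ker‖, ‖kerT‖ ≤ C_E·g_b·e^{−κ𝓛}`, `g_b = g_{K-b} = √(γL^{-(K-b)})` = run `K`'s displayed `S.gk b` (G3D-01 `chart`), the coupling at the chart's
birth level — the lossless reading of the displayed `chart : ChartAnalyticityAsCited (Ψ Y) ρ (C25·g_k·e^{−κ dj Y})` by Cauchy estimates (the `g_k` KEPT).
[cite: Balaban1985UV3, Prop. 3 (34) p.264] -/
def KernelSizeΦg (D : AlphaDataT3 F γ) (Φ : ChartFam 𝕍 F) (κ C_E : ℝ) : Prop :=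
  ∀ (K k b : ℕ) (Y : Set (Site (F.P K) 0)), Y ∈ D.Loc K k (D.triv K k) (1 + b) →
    ∀ d ∈ Finset.Ico 2 7,
      ‖ker Φ K b Y d‖ ≤ C_E * gCo F.L γ (K - b) * Real.exp (-κ * D.treeLen K (1 + b) Y) ∧
      ‖kerT Φ K b Y d‖ ≤ C_E * gCo F.L γ (K - b) * Real.exp (-κ * D.treeLen K (1 + b) Y)

/-- **K1a WITH THE BIRTH COUPLING** (the `g`-carrying flat-kernel Cauchy row: kernels are activities of size `O(g_b)`, so is their two-run difference).
[cite: King1986, Prop. 3.6 (3.56) p.662] -/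
def FlatKernelCauchyΦg (D : AlphaDataT3 F γ) (Φ : ChartFam 𝕍 F) (κ a C : ℝ) : Prop :=
  ∀ (K k b : ℕ) (Y : Set (Site (F.P K) 0)), Y ∈ D.Loc K k (D.triv K k) (1 + b) →
    ∀ d ∈ Finset.Ico 2 7,
      ‖kerT Φ K b Y d - ker Φ K b Y d‖ ≤
        C * gCo F.L γ (K - b) * Real.exp (-κ * D.treeLen K (1 + b) Y) * (((F.L : ℝ) ^ (1 + b))⁻¹) ^ a

/-- **HONEST CONFIGURATION SIZE ROW** = `CfgSizeΦ` with print's collar polylogarithm `r(g_b)` of (28) at the chart's birth coupling (both runs: the matched charts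
`(K, j)`, `(K+1, j+1)` have the same birth index `K-j = (K+1)-(j+1)`; at the birth level `K-n = j+1` the weight is literally `bound28`'s `rFun r₀ (S.gk j)`). [cite: Balaban1985UV3, (28) p.263, (7) p.257] -/
def CfgSizeΦr (D : AlphaDataT3 F γ) (B : CfgFam 𝕍 F) (b₀ p₀ r₀ C_s : ℝ) : Prop :=
  ∀ (K n : ℕ) (h : n ≤ K), ∀ j : ℕ, j < K - n →
    ∀ V : GaugeField (F.P n) 0 (Matrix.specialUnitaryGroup (Fin 2) ℂ), PlaqSmall (θBal F.L γ b₀ p₀ n) V →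
      ∀ Y ∈ D.Loc K (K - n) (D.triv K (K - n)) (1 + j),
        ‖B K (K - n) j Y
            (fieldShift (F.sitesPerDir_eq (m := F.m) (K := K) (j := K - n) (m' := F.m) (K' := n) (j' := 0) (by omega)) V)‖ ≤
          collarW F.L γ r₀ (K - j) * (C_s * θBal F.L γ b₀ p₀ n * (((F.L : ℝ) ^ (K - n - 1 - j))⁻¹) ^ 2) ∧
        ‖(fun c => B (K + 1) (K + 1 - n) (j + 1) (refineSet F K Y)
            (fieldShift (F.sitesPerDir_eq (m := F.m) (K := K + 1) (j := K + 1 - n) (m' := F.m) (K' := n) (j' := 0) (by omega)) V)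
            (matchBond F K j c))‖ ≤
          collarW F.L γ r₀ (K - j) * (C_s * θBal F.L γ b₀ p₀ n * (((F.L : ℝ) ^ (K - n - 1 - j))⁻¹) ^ 2)

/-- **HONEST CONFIGURATION CAUCHY ROW** = `CfgCauchyΦ` with the collar polylogarithm `r(g_b)`. [cite: King1986, Prop. 3.9 (3.71) p.665] -/
def CfgCauchyΦr (D : AlphaDataT3 F γ) (B : CfgFam 𝕍 F) (b₀ p₀ r₀ a C_B : ℝ) (ℓ : ℕ → ℝ) : Prop :=
  ∀ (K n : ℕ) (h : n ≤ K), ∀ j : ℕ, j < K - n →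
    ∀ V : GaugeField (F.P n) 0 (Matrix.specialUnitaryGroup (Fin 2) ℂ), PlaqSmall (θBal F.L γ b₀ p₀ n) V →
      ∀ Y ∈ D.Loc K (K - n) (D.triv K (K - n)) (1 + j),
        ‖(fun c => B (K + 1) (K + 1 - n) (j + 1) (refineSet F K Y)
              (fieldShift (F.sitesPerDir_eq (m := F.m) (K := K + 1) (j := K + 1 - n) (m' := F.m) (K' := n) (j' := 0) (by omega)) V)
              (matchBond F K j c)) -
            B K (K - n) j Y
              (fieldShift (F.sitesPerDir_eq (m := F.m) (K := K) (j := K - n) (m' := F.m) (K' := n) (j' := 0) (by omega)) V)‖ ≤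
          collarW F.L γ r₀ (K - j) *
            (C_B * θBal F.L γ b₀ p₀ n * (((F.L : ℝ) ^ (K - n - 1 - j))⁻¹) ^ 2 * (ℓ n * (((F.L : ℝ) ^ (1 + j))⁻¹) ^ a))

/-- THE RESCALED CHART FAMILY `Φ̃ K b Y z := Φ K b Y (λ_{K-b} • z)` (weights `w` by birth index). [cite: Balaban1985UV3, (30) p.263] -/
def rescaleΦ (w : ℕ → ℝ) (Φ : ChartFam 𝕍 F) : ChartFam 𝕍 F :=
  fun K b Y z => Φ K b Y (((w (K - b) : ℝ) : ℂ) • z)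

/-- THE RESCALED CONFIGURATION FAMILY `B̃ K k b Y W := λ_{K-b}⁻¹ • B K k b Y W`. [cite: Balaban1985UV3, (27)-(28) p.263] -/
def rescaleB (w : ℕ → ℝ) (B : CfgFam 𝕍 F) : CfgFam 𝕍 F :=
  fun K k b Y W => ((w (K - b) : ℝ) : ℂ)⁻¹ • B K k b Y W

/-- `ker Φ̃ K b Y d = λ^d • ker Φ K b Y d`. [folklore] -/
theorem ker_rescale (w : ℕ → ℝ) (hw : ∀ i, w i ≠ 0) (Φ : ChartFam 𝕍 F) (K b : ℕ) (Y : Set (Site (F.P K) 0)) (d : ℕ) :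
    ker (rescaleΦ w Φ) K b Y d = (((w (K - b) : ℝ) : ℂ)) ^ d • ker Φ K b Y d := by
  show iteratedFDeriv ℂ d (fun z => Φ K b Y (((w (K - b) : ℝ) : ℂ) • z)) 0 = _
  exact iteratedFDeriv_comp_smul_zero (Φ K b Y) (Complex.ofReal_ne_zero.mpr (hw _)) d

/-- `kerT Φ̃ K b Y d = λ^d • kerT Φ K b Y d` (the matched chart `(K+1, b+1)` has the same birth height). [folklore] -/
theorem kerT_rescale (w : ℕ → ℝ) (hw : ∀ i, w i ≠ 0) (Φ : ChartFam 𝕍 F) (K b : ℕ) (Y : Set (Site (F.P K) 0)) (d : ℕ) :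
    kerT (rescaleΦ w Φ) K b Y d = (((w (K - b) : ℝ) : ℂ)) ^ d • kerT Φ K b Y d := by
  have hidx : K + 1 - (b + 1) = K - b := by omega
  unfold kerT
  rw [ker_rescale w hw Φ (K + 1) (b + 1), hidx]
  ext v
  simp only [ContinuousMultilinearMap.compContinuousLinearMap_apply, smul_apply]

/-- A scalar pulls out of the sup norm of a pulled-back configuration. [folklore] -/
theorem norm_smul_pullback {K j : ℕ} (c : ℂ) (x' : PBond (F.P (K + 1)) (j + 1) → 𝕍) :
    ‖(fun b => c • x' (matchBond F K j b))‖ = ‖c‖ * ‖(fun b => x' (matchBond F K j b))‖ := by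
  rw [← norm_smul]
  rfl

/-- A scalar pulls out of the sup norm of a difference of (pulled-back) configurations. [folklore] -/
theorem norm_smul_pullback_sub {K j : ℕ} (c : ℂ) (x' : PBond (F.P (K + 1)) (j + 1) → 𝕍) (x : PBond (F.P K) j → 𝕍) :
    ‖(fun b => c • x' (matchBond F K j b)) - c • x‖ = ‖c‖ * ‖(fun b => x' (matchBond F K j b)) - x‖ := by
  rw [← norm_smul, smul_sub]
  rfl

/-- `c • x − c • y = c • (x − y)` for flat kernels (explicit instance path for `rw`). [folklore] -/
theorem smul_sub_rescale {K b d : ℕ} (c : ℂ) (x y : ContinuousMultilinearMap ℂ (fun _ : Fin d => PBond (F.P K) b → 𝕍) ℂ) :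
    c • (x - y) = c • x - c • y :=
  smul_sub c x y

end Rows

/-! ## §4 Transfer: honest rows for `(Φ, B)` ⟹ rows of record for `(Φ̃, B̃)`; the landed composition applies by name -/

section Transfer

variable {𝕍 : Type} [NormedAddCommGroup 𝕍] [NormedSpace ℂ 𝕍] {F : T3Family} {γ : ℝ}

/-- The structure row is invariant: `TaylorSplitΦ PT Φ e B R → TaylorSplitΦ PT Φ̃ e B̃ R` (same `PT, e, R`). [cite: Balaban1985UV3, (30) p.263] -/
theorem taylorSplitΦ_rescale (w : ℕ → ℝ) (hw : ∀ i, w i ≠ 0) {PT : TermFn F} {Φ : ChartFam 𝕍 F} {e : VacFam F} {B : CfgFam 𝕍 F}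
    {R : RemFam F} (hT : TaylorSplitΦ PT Φ e B R) : TaylorSplitΦ PT (rescaleΦ w Φ) e (rescaleB w B) R := by
  intro K k b Y W
  have hj : jet26 (rescaleΦ w Φ K b Y) (rescaleB w B K k b Y W) = jet26 (Φ K b Y) (B K k b Y W) :=
    jet26_comp_smul (Φ K b Y) (Complex.ofReal_ne_zero.mpr (hw (K - b))) (B K k b Y W)
  rw [hj]
  exact hT K k b Y W

/-- `CfgSizeΦr D B … r₀ C_s → CfgSizeΦ D B̃ … C_s`. [cite: Balaban1985UV3, (28) p.263] -/
theorem cfgSizeΦ_rescale {D : AlphaDataT3 F γ} {B : CfgFam 𝕍 F} {b₀ p₀ r₀ C_s : ℝ} (hL : 1 ≤ F.L) (hγ : 0 < γ) (hγ1 : γ ≤ 1)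
    (hr : 0 ≤ r₀) (hS : CfgSizeΦr D B b₀ p₀ r₀ C_s) : CfgSizeΦ D (rescaleB (collarW F.L γ r₀) B) b₀ p₀ C_s := by
  intro K n hn j hj V hV Y hY
  obtain ⟨h1, h2⟩ := hS K n hn j hj V hV Y hY
  have hw := collarW_pos hL hγ hγ1 hr (K - j)
  have hidx : K + 1 - (j + 1) = K - j := by omega
  have hnorm : ‖((collarW F.L γ r₀ (K - j) : ℝ) : ℂ)⁻¹‖ = (collarW F.L γ r₀ (K - j))⁻¹ := by
    rw [norm_inv, Complex.norm_real, Real.norm_of_nonneg hw.le]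
  simp only [rescaleB, Pi.smul_apply, hidx]
  refine ⟨?_, ?_⟩
  · rw [norm_smul, hnorm, inv_mul_le_iff₀ hw]
    exact h1
  · rw [norm_smul_pullback, hnorm, inv_mul_le_iff₀ hw]
    exact h2

/-- `CfgCauchyΦr D B … r₀ a C_B ℓ → CfgCauchyΦ D B̃ … a C_B ℓ`. [cite: King1986, Prop. 3.9 (3.71) p.665] -/
theorem cfgCauchyΦ_rescale {D : AlphaDataT3 F γ} {B : CfgFam 𝕍 F} {b₀ p₀ r₀ a C_B : ℝ} {ℓ : ℕ → ℝ} (hL : 1 ≤ F.L)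
    (hγ : 0 < γ) (hγ1 : γ ≤ 1) (hr : 0 ≤ r₀) (hBC : CfgCauchyΦr D B b₀ p₀ r₀ a C_B ℓ) :
    CfgCauchyΦ D (rescaleB (collarW F.L γ r₀) B) b₀ p₀ a C_B ℓ := by
  intro K n hn j hj V hV Y hY
  have h := hBC K n hn j hj V hV Y hY
  have hw := collarW_pos hL hγ hγ1 hr (K - j)
  have hidx : K + 1 - (j + 1) = K - j := by omega
  have hnorm : ‖((collarW F.L γ r₀ (K - j) : ℝ) : ℂ)⁻¹‖ = (collarW F.L γ r₀ (K - j))⁻¹ := by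
    rw [norm_inv, Complex.norm_real, Real.norm_of_nonneg hw.le]
  simp only [rescaleB, Pi.smul_apply, hidx]
  rw [norm_smul_pullback_sub, hnorm, inv_mul_le_iff₀ hw]
  exact h

omit [NormedSpace ℂ 𝕍] in
/-- Rate monotonicity of the configuration Cauchy row: `a' ≤ a` (with `C_B, θ, ℓ ≥ 0`, `L ≥ 1`). [folklore] -/
theorem cfgCauchyΦ_rate_mono {D : AlphaDataT3 F γ} {B : CfgFam 𝕍 F} {b₀ p₀ a a' C_B : ℝ} {ℓ : ℕ → ℝ} (hL : 1 ≤ F.L)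
    (hCB : 0 ≤ C_B) (hθ0 : ∀ n, 0 ≤ θBal F.L γ b₀ p₀ n) (hℓ : ∀ n, 0 ≤ ℓ n) (ha : a' ≤ a)
    (hBC : CfgCauchyΦ D B b₀ p₀ a C_B ℓ) : CfgCauchyΦ D B b₀ p₀ a' C_B ℓ := by
  intro K n hn j hj V hV Y hY
  refine (hBC K n hn j hj V hV Y hY).trans ?_
  have hL' : (1 : ℝ) ≤ F.L := by exact_mod_cast hL
  have hx0 : 0 < ((F.L : ℝ) ^ (1 + j))⁻¹ := inv_pos.mpr (pow_pos (by linarith) _)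
  have hx1 : ((F.L : ℝ) ^ (1 + j))⁻¹ ≤ 1 := inv_le_one_of_one_le₀ (one_le_pow₀ hL')
  have hmono : ((F.L : ℝ) ^ (1 + j))⁻¹ ^ a ≤ ((F.L : ℝ) ^ (1 + j))⁻¹ ^ a' := Real.rpow_le_rpow_of_exponent_ge hx0 hx1 ha
  have h0 : 0 ≤ C_B * θBal F.L γ b₀ p₀ n * (((F.L : ℝ) ^ (K - n - 1 - j))⁻¹) ^ 2 :=
    mul_nonneg (mul_nonneg hCB (hθ0 n)) (pow_nonneg (inv_nonneg.mpr (pow_nonneg (by linarith) _)) 2)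
  exact mul_le_mul_of_nonneg_left (mul_le_mul_of_nonneg_left hmono (hℓ n)) h0

/-- `KernelSizeΦg D Φ κ C_E → KernelSizeΦ D Φ̃ κ (C_E·M(6r₀,1))` — the coupling pays the collar. [cite: Balaban1985UV3, Prop. 3 (34) p.264] -/
theorem kernelSizeΦ_rescale {D : AlphaDataT3 F γ} {Φ : ChartFam 𝕍 F} {κ C_E r₀ : ℝ} (hL : 1 ≤ F.L) (hγ : 0 < γ) (hγ1 : γ ≤ 1)
    (hr : 0 ≤ r₀) (hCE : 0 ≤ C_E) (hE : KernelSizeΦg D Φ κ C_E) :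
    KernelSizeΦ D (rescaleΦ (collarW F.L γ r₀) Φ) κ (C_E * logPowConst (6 * r₀) 1) := by
  intro K k b Y hY d hd
  have hd6 : d ≤ 6 := by have := (Finset.mem_Ico.1 hd).2; omega
  obtain ⟨h1, -⟩ := hE K k b Y hY d hd
  have hw0 : ∀ i, collarW F.L γ r₀ i ≠ 0 := fun i => (collarW_pos hL hγ hγ1 hr i).ne'
  have hwpos := collarW_pos hL hγ hγ1 hr (K - b)
  rw [ker_rescale _ hw0, norm_smul, norm_pow, Complex.norm_real, Real.norm_of_nonneg hwpos.le]
  have key : collarW F.L γ r₀ (K - b) ^ d * gCo F.L γ (K - b) ≤ logPowConst (6 * r₀) 1 :=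
    collarW_pow_mul_gCo_le hL hγ hγ1 hr hd6 _
  have hex : 0 ≤ Real.exp (-κ * D.treeLen K (1 + b) Y) := (Real.exp_pos _).le
  calc collarW F.L γ r₀ (K - b) ^ d * ‖ker Φ K b Y d‖
      ≤ collarW F.L γ r₀ (K - b) ^ d * (C_E * gCo F.L γ (K - b) * Real.exp (-κ * D.treeLen K (1 + b) Y)) :=
        mul_le_mul_of_nonneg_left h1 (pow_nonneg hwpos.le d)
    _ = C_E * (collarW F.L γ r₀ (K - b) ^ d * gCo F.L γ (K - b)) * Real.exp (-κ * D.treeLen K (1 + b) Y) := by ring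
    _ ≤ C_E * logPowConst (6 * r₀) 1 * Real.exp (-κ * D.treeLen K (1 + b) Y) :=
        mul_le_mul_of_nonneg_right (mul_le_mul_of_nonneg_left key hCE) hex

/-- LOSSLESS K1a transfer: `FlatKernelCauchyΦg D Φ κ a C → FlatKernelCauchyΦ D Φ̃ κ a (C·M(6r₀,1))`. [cite: King1986, Prop. 3.6 (3.56) p.662] -/
theorem flatKernelCauchyΦ_rescale_g {D : AlphaDataT3 F γ} {Φ : ChartFam 𝕍 F} {κ a C r₀ : ℝ} (hL : 1 ≤ F.L) (hγ : 0 < γ)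
    (hγ1 : γ ≤ 1) (hr : 0 ≤ r₀) (hC : 0 ≤ C) (hK : FlatKernelCauchyΦg D Φ κ a C) :
    FlatKernelCauchyΦ D (rescaleΦ (collarW F.L γ r₀) Φ) κ a (C * logPowConst (6 * r₀) 1) := by
  intro K k b Y hY d hd
  have hd6 : d ≤ 6 := by have := (Finset.mem_Ico.1 hd).2; omega
  have h1 := hK K k b Y hY d hd
  have hw0 : ∀ i, collarW F.L γ r₀ i ≠ 0 := fun i => (collarW_pos hL hγ hγ1 hr i).ne'
  have hwpos := collarW_pos hL hγ hγ1 hr (K - b)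
  rw [kerT_rescale _ hw0, ker_rescale _ hw0, ← smul_sub_rescale, norm_smul, norm_pow, Complex.norm_real,
    Real.norm_of_nonneg hwpos.le]
  have key : collarW F.L γ r₀ (K - b) ^ d * gCo F.L γ (K - b) ≤ logPowConst (6 * r₀) 1 :=
    collarW_pow_mul_gCo_le hL hγ hγ1 hr hd6 _
  have hex : 0 ≤ Real.exp (-κ * D.treeLen K (1 + b) Y) := (Real.exp_pos _).le
  have hx : 0 ≤ (((F.L : ℝ) ^ (1 + b))⁻¹) ^ a := Real.rpow_nonneg (inv_nonneg.mpr (pow_nonneg (Nat.cast_nonneg _) _)) _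
  calc collarW F.L γ r₀ (K - b) ^ d * ‖kerT Φ K b Y d - ker Φ K b Y d‖
      ≤ collarW F.L γ r₀ (K - b) ^ d *
          (C * gCo F.L γ (K - b) * Real.exp (-κ * D.treeLen K (1 + b) Y) * (((F.L : ℝ) ^ (1 + b))⁻¹) ^ a) :=
        mul_le_mul_of_nonneg_left h1 (pow_nonneg hwpos.le d)
    _ = C * (collarW F.L γ r₀ (K - b) ^ d * gCo F.L γ (K - b)) * Real.exp (-κ * D.treeLen K (1 + b) Y) *
          (((F.L : ℝ) ^ (1 + b))⁻¹) ^ a := by ring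
    _ ≤ C * logPowConst (6 * r₀) 1 * Real.exp (-κ * D.treeLen K (1 + b) Y) * (((F.L : ℝ) ^ (1 + b))⁻¹) ^ a :=
        mul_le_mul_of_nonneg_right (mul_le_mul_of_nonneg_right (mul_le_mul_of_nonneg_left key hC) hex) hx

/-- INTERPOLATED K1a transfer from the VERBATIM row of record: `FlatKernelCauchyΦ D Φ κ a C ∧ KernelSizeΦg D Φ κ C_E →
FlatKernelCauchyΦ D Φ̃ κ (a(1-t)) (C^{1-t}(2C_E)^t·M(6r₀,t))` for `0 < t ≤ 1`. [cite: King1986, Prop. 3.6 (3.56) p.662] -/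
theorem flatKernelCauchyΦ_rescale {D : AlphaDataT3 F γ} {Φ : ChartFam 𝕍 F} {κ a C C_E r₀ t : ℝ} (hL : 1 ≤ F.L) (hγ : 0 < γ)
    (hγ1 : γ ≤ 1) (hr : 0 ≤ r₀) (hC : 0 ≤ C) (hCE : 0 ≤ C_E) (ht : 0 < t) (ht1 : t ≤ 1)
    (hK : FlatKernelCauchyΦ D Φ κ a C) (hE : KernelSizeΦg D Φ κ C_E) :
    FlatKernelCauchyΦ D (rescaleΦ (collarW F.L γ r₀) Φ) κ (a * (1 - t))
      (C ^ (1 - t) * (2 * C_E) ^ t * logPowConst (6 * r₀) t) := by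
  intro K k b Y hY d hd
  have hd6 : d ≤ 6 := by have := (Finset.mem_Ico.1 hd).2; omega
  have hN := hK K k b Y hY d hd
  obtain ⟨h1, h2⟩ := hE K k b Y hY d hd
  have hw0 : ∀ i, collarW F.L γ r₀ i ≠ 0 := fun i => (collarW_pos hL hγ hγ1 hr i).ne'
  have hwpos := collarW_pos hL hγ hγ1 hr (K - b)
  rw [kerT_rescale _ hw0, ker_rescale _ hw0, ← smul_sub_rescale, norm_smul, norm_pow, Complex.norm_real,
    Real.norm_of_nonneg hwpos.le]
  set w := collarW F.L γ r₀ (K - b) with hw_def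
  set g := gCo F.L γ (K - b) with hg_def
  set ex := Real.exp (-κ * D.treeLen K (1 + b) Y) with hex_def
  set x := ((F.L : ℝ) ^ (1 + b))⁻¹ with hx_def
  set N := ‖kerT Φ K b Y d - ker Φ K b Y d‖ with hN_def
  have hx0 : 0 ≤ x := inv_nonneg.mpr (pow_nonneg (Nat.cast_nonneg _) _)
  have hg0 : 0 < g := gCo_pos hL hγ _
  have hex : 0 < ex := Real.exp_pos _
  have hN2 : N ≤ 2 * C_E * g * ex := by
    calc N ≤ ‖kerT Φ K b Y d‖ + ‖ker Φ K b Y d‖ := norm_sub_le _ _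
      _ ≤ C_E * g * ex + C_E * g * ex := add_le_add h2 h1
      _ = 2 * C_E * g * ex := by ring
  have hA0 : 0 ≤ C * ex * x ^ a := mul_nonneg (mul_nonneg hC hex.le) (Real.rpow_nonneg hx0 _)
  have h2CE : 0 ≤ 2 * C_E := by linarith
  have hB0 : 0 ≤ 2 * C_E * g * ex := mul_nonneg (mul_nonneg h2CE hg0.le) hex.le
  have hmin : N ≤ min (C * ex * x ^ a) (2 * C_E * g * ex) := le_min hN hN2
  have hint := min_le_rpow_mul_rpow hA0 hB0 ht.le ht1
  have hee : ex ^ (1 - t) * ex ^ t = ex := by rw [← Real.rpow_add hex, sub_add_cancel, Real.rpow_one]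
  have hexp : (C * ex * x ^ a) ^ (1 - t) * (2 * C_E * g * ex) ^ t =
      C ^ (1 - t) * (2 * C_E) ^ t * g ^ t * ex * x ^ (a * (1 - t)) := by
    rw [Real.mul_rpow (mul_nonneg hC hex.le) (Real.rpow_nonneg hx0 _), Real.mul_rpow hC hex.le,
      Real.mul_rpow (mul_nonneg h2CE hg0.le) hex.le, Real.mul_rpow h2CE hg0.le, ← Real.rpow_mul hx0]
    calc C ^ (1 - t) * ex ^ (1 - t) * x ^ (a * (1 - t)) * ((2 * C_E) ^ t * g ^ t * ex ^ t)
        = C ^ (1 - t) * (2 * C_E) ^ t * g ^ t * (ex ^ (1 - t) * ex ^ t) * x ^ (a * (1 - t)) := by ring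
      _ = C ^ (1 - t) * (2 * C_E) ^ t * g ^ t * ex * x ^ (a * (1 - t)) := by rw [hee]
  have key : w ^ d * g ^ t ≤ logPowConst (6 * r₀) t := collarW_pow_mul_gCo_rpow_le hL hγ hγ1 hr hd6 _ ht
  have hc0 : 0 ≤ C ^ (1 - t) * (2 * C_E) ^ t := mul_nonneg (Real.rpow_nonneg hC _) (Real.rpow_nonneg h2CE _)
  calc w ^ d * N ≤ w ^ d * (C ^ (1 - t) * (2 * C_E) ^ t * g ^ t * ex * x ^ (a * (1 - t))) := by
        refine mul_le_mul_of_nonneg_left ?_ (pow_nonneg hwpos.le d)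
        calc N ≤ min (C * ex * x ^ a) (2 * C_E * g * ex) := hmin
          _ ≤ (C * ex * x ^ a) ^ (1 - t) * (2 * C_E * g * ex) ^ t := hint
          _ = _ := hexp
    _ = C ^ (1 - t) * (2 * C_E) ^ t * (w ^ d * g ^ t) * ex * x ^ (a * (1 - t)) := by ring
    _ ≤ C ^ (1 - t) * (2 * C_E) ^ t * logPowConst (6 * r₀) t * ex * x ^ (a * (1 - t)) :=
        mul_le_mul_of_nonneg_right (mul_le_mul_of_nonneg_right (mul_le_mul_of_nonneg_left key hc0) hex.le)
          (Real.rpow_nonneg hx0 _)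

/-- **THE LANDED COMPOSITION APPLIES BY NAME — LOSSLESS FORM** (`g`-carrying K1a): honest rows for `(Φ, B)` ⟹ the local slack row of 3⁗'s producer at
`σ = 7`, profile `θBal(b₀, p₀)`, rate `a`. [cite: King1986, Prop. 3.6 (3.56) p.662; Balaban1985UV3, (28) p.263, (34) p.264] -/
theorem polymerCauchyMinAtTSlack_of_honest_charts_g {D : AlphaDataT3 F γ} {PT : TermFn F} {Φ : ChartFam 𝕍 F} {e : VacFam F}
    {B : CfgFam 𝕍 F} {R : RemFam F} {b₀ p₀ κ a C C_E C_R C_s C_B r₀ : ℝ}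
    (hC : 0 ≤ C) (hCE : 0 ≤ C_E) (hCR : 0 ≤ C_R) (hCs : 0 ≤ C_s) (hCB : 0 ≤ C_B) (hL : 1 ≤ F.L) (hγ : 0 < γ) (hγ1 : γ ≤ 1)
    (hr : 0 ≤ r₀) (hθ0 : ∀ n, 0 ≤ θBal F.L γ b₀ p₀ n) (hθ1 : ∀ n, (C_s + C_B) * θBal F.L γ b₀ p₀ n ≤ 1)
    (hT : TaylorSplitΦ PT Φ e B R) (hK : FlatKernelCauchyΦg D Φ κ a C) (hE : KernelSizeΦg D Φ κ C_E)
    (hR : RemainderSmallΦ D R b₀ p₀ κ C_R) (hS : CfgSizeΦr D B b₀ p₀ r₀ C_s) (hBC : CfgCauchyΦr D B b₀ p₀ r₀ a C_B fun _ => 1) :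
    PolymerCauchyMinAtTSlack D PT b₀ p₀ κ a 7
      (5 * (C_s ^ 2 * (C * logPowConst (6 * r₀) 1) + 6 * C_s * C_B * (C_E * logPowConst (6 * r₀) 1)) + 2 * C_R) := by
  have hL' : 1 ≤ (F.L : ℝ) := by exact_mod_cast hL
  have hw0 : ∀ i, collarW F.L γ r₀ i ≠ 0 := fun i => (collarW_pos hL hγ hγ1 hr i).ne'
  have hM : 0 ≤ logPowConst (6 * r₀) 1 := (logPowConst_pos (by nlinarith) one_pos).le
  exact polymerCauchyMinAtTSlack_of_charts (mul_nonneg hC hM) (mul_nonneg hCE hM) hCR hCs hCB hL' hθ0 hθ1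
    (taylorSplitΦ_rescale _ hw0 hT) (flatKernelCauchyΦ_rescale_g hL hγ hγ1 hr hC hK) (kernelSizeΦ_rescale hL hγ hγ1 hr hCE hE)
    hR (cfgSizeΦ_rescale hL hγ hγ1 hr hS) (cfgCauchyΦ_rescale hL hγ hγ1 hr hBC)

/-- **THE LANDED COMPOSITION APPLIES BY NAME — VERBATIM K1a ROW OF RECORD** (no `g` in K1a; interpolation exponent `0 < t ≤ 1`): honest rows for `(Φ, B)`
⟹ the local slack row at `σ = 7`, profile `θBal(b₀, p₀)`, rate `a(1-t)`. [cite: King1986, Prop. 3.6 (3.56) p.662; Balaban1985UV3, (28) p.263, (34) p.264] -/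
theorem polymerCauchyMinAtTSlack_of_honest_charts {D : AlphaDataT3 F γ} {PT : TermFn F} {Φ : ChartFam 𝕍 F} {e : VacFam F}
    {B : CfgFam 𝕍 F} {R : RemFam F} {b₀ p₀ κ a C C_E C_R C_s C_B r₀ t : ℝ}
    (hC : 0 ≤ C) (hCE : 0 ≤ C_E) (hCR : 0 ≤ C_R) (hCs : 0 ≤ C_s) (hCB : 0 ≤ C_B) (hL : 1 ≤ F.L) (hγ : 0 < γ) (hγ1 : γ ≤ 1)
    (hr : 0 ≤ r₀) (ha : 0 ≤ a) (ht : 0 < t) (ht1 : t ≤ 1)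
    (hθ0 : ∀ n, 0 ≤ θBal F.L γ b₀ p₀ n) (hθ1 : ∀ n, (C_s + C_B) * θBal F.L γ b₀ p₀ n ≤ 1)
    (hT : TaylorSplitΦ PT Φ e B R) (hK : FlatKernelCauchyΦ D Φ κ a C) (hE : KernelSizeΦg D Φ κ C_E)
    (hR : RemainderSmallΦ D R b₀ p₀ κ C_R) (hS : CfgSizeΦr D B b₀ p₀ r₀ C_s) (hBC : CfgCauchyΦr D B b₀ p₀ r₀ a C_B fun _ => 1) :
    PolymerCauchyMinAtTSlack D PT b₀ p₀ κ (a * (1 - t)) 7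
      (5 * (C_s ^ 2 * (C ^ (1 - t) * (2 * C_E) ^ t * logPowConst (6 * r₀) t) +
        6 * C_s * C_B * (C_E * logPowConst (6 * r₀) 1)) + 2 * C_R) := by
  have hL' : 1 ≤ (F.L : ℝ) := by exact_mod_cast hL
  have hw0 : ∀ i, collarW F.L γ r₀ i ≠ 0 := fun i => (collarW_pos hL hγ hγ1 hr i).ne'
  have hM1 : 0 ≤ logPowConst (6 * r₀) 1 := (logPowConst_pos (by nlinarith) one_pos).le
  have hMt : 0 ≤ logPowConst (6 * r₀) t := (logPowConst_pos (by nlinarith) ht).le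
  have hC' : 0 ≤ C ^ (1 - t) * (2 * C_E) ^ t * logPowConst (6 * r₀) t :=
    mul_nonneg (mul_nonneg (Real.rpow_nonneg hC _) (Real.rpow_nonneg (by linarith) _)) hMt
  have ha' : a * (1 - t) ≤ a := by nlinarith
  exact polymerCauchyMinAtTSlack_of_charts hC' (mul_nonneg hCE hM1) hCR hCs hCB hL' hθ0 hθ1
    (taylorSplitΦ_rescale _ hw0 hT) (flatKernelCauchyΦ_rescale hL hγ hγ1 hr hC hCE ht ht1 hK hE)
    (kernelSizeΦ_rescale hL hγ hγ1 hr hCE hE) hR (cfgSizeΦ_rescale hL hγ hγ1 hr hS)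
    (cfgCauchyΦ_rate_mono hL hCB hθ0 (fun _ => zero_le_one) ha' (cfgCauchyΦ_rescale hL hγ hγ1 hr hBC))

end Transfer

/-! ## §5 Step (iii) in honest currency: the displayed chart row WITH its coupling ⟹ `KernelSizeΦg` and the honest Taylor rest -/


section Coupling2

variable {L : ℕ} {γ r₀ : ℝ}

/-- The birth couplings along the hierarchy: `log g_{n+m}⁻¹ = log g_n⁻¹ + ½ log Lᵐ`. [cite: Balaban1985UV3, (3) p.256] -/
theorem log_inv_gCo_add (hL : 1 ≤ L) (hγ : 0 < γ) (n m : ℕ) :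
    Real.log (gCo L γ (n + m))⁻¹ = Real.log (gCo L γ n)⁻¹ + Real.log (((L : ℝ) ^ m)⁻¹)⁻¹ / 2 := by
  have hL0 : (0 : ℝ) < L := by exact_mod_cast (show 0 < L by omega)
  have hA : 0 < γ * ((L : ℝ)⁻¹) ^ n := mul_pos hγ (pow_pos (inv_pos.mpr hL0) n)
  have hx : 0 < ((L : ℝ)⁻¹) ^ m := pow_pos (inv_pos.mpr hL0) m
  unfold gCo
  rw [pow_add, ← mul_assoc, Real.sqrt_mul hA.le, inv_inv]
  simp only [Real.log_inv]
  rw [Real.log_mul (Real.sqrt_pos.mpr hA).ne' (Real.sqrt_pos.mpr hx).ne', Real.log_sqrt hx.le]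
  simp only [inv_pow, Real.log_inv]
  ring

/-- **SPLITTING OF THE COLLAR WEIGHT ALONG THE HIERARCHY**: `λ_{n+m} ≤ λ_n · (1 + log Lᵐ)^{r₀}` (`1 + a + u/2 ≤ (1+a)(1+u)`). [cite: Balaban1985UV3, (7) p.257] -/
theorem collarW_add_le (hL : 1 ≤ L) (hγ : 0 < γ) (hγ1 : γ ≤ 1) (hr : 0 ≤ r₀) (n m : ℕ) :
    collarW L γ r₀ (n + m) ≤ collarW L γ r₀ n * (1 + Real.log (((L : ℝ) ^ m)⁻¹)⁻¹) ^ r₀ := by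
  have ha := B10.log_inv_nonneg_of_le_one (gCo_pos hL hγ n) (gCo_le_one hL hγ hγ1 n)
  have hL1 : (1 : ℝ) ≤ L := by exact_mod_cast hL
  have hx0 : 0 < ((L : ℝ) ^ m)⁻¹ := by positivity
  have hx1 : ((L : ℝ) ^ m)⁻¹ ≤ 1 := inv_le_one_of_one_le₀ (one_le_pow₀ hL1)
  have hu := B10.log_inv_nonneg_of_le_one hx0 hx1
  unfold collarW B10.rFun
  rw [log_inv_gCo_add hL hγ n m, ← Real.mul_rpow (by linarith) (by linarith)]
  exact Real.rpow_le_rpow (by linarith) (by nlinarith [mul_nonneg ha hu]) hr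

/-- **The coupling pays any power of the collar**: `λ_i^d · g_i ≤ M(d·r₀, 1)`. [cite: Balaban1985UV3, (7) p.257] -/
theorem collarW_pow_mul_gCo_le' (hL : 1 ≤ L) (hγ : 0 < γ) (hγ1 : γ ≤ 1) (hr : 0 ≤ r₀) (d i : ℕ) :
    collarW L γ r₀ i ^ d * gCo L γ i ≤ logPowConst (d * r₀) 1 := by
  have hg := gCo_pos hL hγ i
  have hg1 := gCo_le_one hL hγ hγ1 i
  have hu := B10.log_inv_nonneg_of_le_one hg hg1
  have hpow : collarW L γ r₀ i ^ d = (1 + Real.log (gCo L γ i)⁻¹) ^ ((d : ℝ) * r₀) := by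
    unfold collarW B10.rFun
    rw [← Real.rpow_natCast, ← Real.rpow_mul (by linarith)]
    congr 1
    ring
  rw [hpow, mul_comm]
  exact mul_logpow_le hg hg1 (mul_nonneg (Nat.cast_nonneg d) hr)

end Coupling2

section Displayed

variable {𝕍 : Type} [NormedAddCommGroup 𝕍] [NormedSpace ℂ 𝕍] {F : T3Family} {γ : ℝ}

/-- THE BIRTH-COUPLING PROFILE of a family: `g K b := g_{K-b} = √(γ L^{-(K-b)})` (= run `K`'s `S.gk b` by `gk_eq_gRun_norm` and `T3Scales`, the coupling displayed in G3D-01 `chart : ChartAnalyticityAsCited ((𝔖 b).Ψ Y) ρ (C25 * S.gk b * exp …)`) — the profile at which the slack pen's keep-`g` rows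
`ChartAnalyticGΦ`/`KernelSizeGΦ` (p532839 §2c) are read here (matched charts `(K,b)`/`(K+1,b+1)` share it). [cite: Balaban1985UV3, (3) p.256, (25) p.262] -/
abbrev gCoFam (F : T3Family) (γ : ℝ) : ℕ → ℕ → ℝ := fun K b => gCo F.L γ (K - b)

/-- The birth-coupling profile lies in `[0, 1]` (for `0 < γ ≤ 1`). [cite: Balaban1985UV3, (3) p.256] -/
theorem gCoFam_window (hL : 1 ≤ F.L) (hγ : 0 < γ) (hγ1 : γ ≤ 1) : ∀ K b, 0 ≤ gCoFam F γ K b ∧ gCoFam F γ K b ≤ 1 :=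
  fun _ _ => ⟨(gCo_pos hL hγ _).le, gCo_le_one hL hγ hγ1 _⟩

/-- **THE PROFILE IS THE LANE'S DISPLAYED RUNNING COUPLING**: `gCoFam F γ K b = (T3Scales F γ hγ hγ1 K).gk b` for `b ≤ K` — literally the `S.gk k` of the displayed
row G3D-01 `chart : ChartAnalyticityAsCited ((𝔖 k).Ψ Y) 𝔠.ρ (𝔠.C25 * S.gk k * exp (−𝔠.κ·dj Y))` at the chart's own step `k = b` (g12 (D1) `ChartsDisplayed`).
[cite: Balaban1985UV3, (3)+(5) p.256, (25) p.262] -/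
theorem gCoFam_eq_gk (hγ : 0 < γ) (hγ1 : γ ≤ 1) {K b : ℕ} (hb : b ≤ K) :
    gCoFam F γ K b = (T3Scales F γ hγ hγ1 K).gk b := by
  have hL : (F.L : ℝ) ≠ 0 := by exact_mod_cast (zero_lt_one.trans F.hL.2).ne'
  have hK : (F.L : ℝ) ^ K = (F.L : ℝ) ^ b * (F.L : ℝ) ^ (K - b) := by rw [← pow_add, Nat.add_sub_cancel' hb]
  show Real.sqrt (γ * ((F.L : ℝ)⁻¹) ^ (K - b)) = Real.sqrt γ * Real.sqrt ((F.L : ℝ) ^ b * ((F.L : ℝ)⁻¹) ^ K)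
  rw [← Real.sqrt_mul hγ.le]
  congr 1
  rw [inv_pow, inv_pow, hK, mul_inv, mul_inv_cancel_left₀ (pow_ne_zero b hL)]

/-- **THE COLLAR WEIGHT IS `bound28`'S POLYLOGARITHM**: `collarW F.L γ r₀ (K - j) = rFun r₀ ((T3Scales F γ hγ hγ1 K).gk j)` for `j ≤ K` — literally the factor
`rFun 𝔠.r₀ (S.gk k)` of the displayed row `bound28 : ‖(𝔖 k).Bcfg Y h U‖ ≤ 𝔠.cB * (rFun 𝔠.r₀ (S.gk k) * S.gk k * pFun 𝔠.b₀ 𝔠.p₀ (S.gk k))` at the configuration's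
birth step `k = j` (g12 (D2) `BirthCfgDisplayed`; the slack pen's REPORT-K1a-display-g0 located exactly this factor). [cite: Balaban1985UV3, (7) p.257, (28) p.263] -/
theorem collarW_eq_rFun_gk (hγ : 0 < γ) (hγ1 : γ ≤ 1) (r₀ : ℝ) {K j : ℕ} (hj : j ≤ K) :
    collarW F.L γ r₀ (K - j) = B10.rFun r₀ ((T3Scales F γ hγ hγ1 K).gk j) := by
  show B10.rFun r₀ (gCoFam F γ K j) = _
  rw [gCoFam_eq_gk hγ hγ1 hj]

/-- The transported kernel is bounded by run `K+1`'s kernel (`‖transport‖ ≤ 1`). [cite: King1986, Prop. 3.6 (3.56) p.662] -/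
theorem norm_kerT_le (Φ : ChartFam 𝕍 F) (K b : ℕ) (Y : Set (Site (F.P K) 0)) (d : ℕ) :
    ‖kerT Φ K b Y d‖ ≤ ‖ker Φ (K + 1) (b + 1) (refineSet F K Y) d‖ := by
  have ht : ‖transport 𝕍 F K b‖ ≤ 1 :=
    ContinuousLinearMap.opNorm_le_bound _ zero_le_one fun x => by simpa only [one_mul] using norm_transport_le K b x
  have hprod : ∏ _i : Fin d, ‖transport 𝕍 F K b‖ ≤ 1 :=
    Finset.prod_le_one (fun _ _ => norm_nonneg _) (fun _ _ => ht)
  calc ‖kerT Φ K b Y d‖ ≤ ‖ker Φ (K + 1) (b + 1) (refineSet F K Y) d‖ * ∏ _i : Fin d, ‖transport 𝕍 F K b‖ :=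
        ContinuousMultilinearMap.norm_compContinuousLinearMap_le _ _
    _ ≤ ‖ker Φ (K + 1) (b + 1) (refineSet F K Y) d‖ * 1 := mul_le_mul_of_nonneg_left hprod (norm_nonneg _)
    _ = ‖ker Φ (K + 1) (b + 1) (refineSet F K Y) d‖ := mul_one _

/-- **`KernelSizeΦg` (BOTH RUNS) IS A THEOREM UNDER THE DISPLAYED KEEP-`g` CHART ROW** (step (iii) losslessly: the slack pen's operator-norm Cauchy inequality
`norm_iteratedFDeriv_zero_le_uniform` by name, at the birth-coupling profile; the run-`K+1` clause through `‖kerT‖ ≤ ‖ker_{K+1}‖`):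
`ChartAnalyticGΦ D Φ κ ρ C_A (gCoFam F γ) ⟹ KernelSizeΦg D Φ κ (C_A·(max 1 (12/ρ))⁶)`. [cite: Balaban1985UV3, Prop. 3 (34) p.264; King1986, (3.55) p.662] -/
theorem kernelSizeΦg_of_chartAnalyticG {D : AlphaDataT3 F γ} {Φ : ChartFam 𝕍 F} {κ ρ C_A : ℝ}
    (h : ChartAnalyticGΦ D Φ κ ρ C_A (gCoFam F γ)) : KernelSizeΦg D Φ κ (C_A * (max 1 (12 / ρ)) ^ 6) := by
  intro K k b Y hY d hd
  have hd6 : d ≤ 6 := by have := (Finset.mem_Ico.mp hd).2; omega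
  obtain ⟨h0, h1⟩ := h.2 K k b Y hY
  have e0 := norm_iteratedFDeriv_zero_le_uniform h0 hd6
  have e1 := norm_iteratedFDeriv_zero_le_uniform h1 hd6
  refine ⟨?_, ?_⟩
  · calc ‖ker Φ K b Y d‖ = ‖iteratedFDeriv ℂ d (Φ K b Y) 0‖ := rfl
      _ ≤ C_A * gCo F.L γ (K - b) * Real.exp (-κ * D.treeLen K (1 + b) Y) * (max 1 (12 / ρ)) ^ 6 := e0
      _ = C_A * (max 1 (12 / ρ)) ^ 6 * gCo F.L γ (K - b) * Real.exp (-κ * D.treeLen K (1 + b) Y) := by ring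
  · calc ‖kerT Φ K b Y d‖ ≤ ‖ker Φ (K + 1) (b + 1) (refineSet F K Y) d‖ := norm_kerT_le Φ K b Y d
      _ = ‖iteratedFDeriv ℂ d (Φ (K + 1) (b + 1) (refineSet F K Y)) 0‖ := rfl
      _ ≤ C_A * gCo F.L γ (K - b) * Real.exp (-κ * D.treeLen K (1 + b) Y) * (max 1 (12 / ρ)) ^ 6 := e1
      _ = C_A * (max 1 (12 / ρ)) ^ 6 * gCo F.L γ (K - b) * Real.exp (-κ * D.treeLen K (1 + b) Y) := by ring

/-- The arithmetic of the honest Taylor rest: `2(C_A g e)(2 λ C_s θ x²/ρ)⁷ ≤ (2C_A(2C_s/ρ)⁷ M) e θ⁷ x⁴` when `λ⁷ g ≤ M`, `0 ≤ x ≤ 1`. [folklore] -/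
theorem taylorRest_arith_r {C_A C_s ρ e θ x lam g Mr : ℝ} (hCA : 0 ≤ C_A) (hCs : 0 ≤ C_s) (hρ : 0 < ρ) (he : 0 ≤ e) (hθ : 0 ≤ θ)
    (hx0 : 0 ≤ x) (hx1 : x ≤ 1) (hlam : 0 ≤ lam) (hg : 0 ≤ g) (hMr : lam ^ 7 * g ≤ Mr) :
    2 * (C_A * g * e) * (2 * (lam * (C_s * θ * x ^ 2)) / ρ) ^ 7 ≤ 2 * C_A * (2 * C_s / ρ) ^ 7 * Mr * e * θ ^ 7 * x ^ 4 := by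
  have hx14 : x ^ 14 ≤ x ^ 4 := pow_le_pow_of_le_one hx0 hx1 (by norm_num)
  have heq : 2 * (C_A * g * e) * (2 * (lam * (C_s * θ * x ^ 2)) / ρ) ^ 7 =
      2 * C_A * (2 * C_s / ρ) ^ 7 * (lam ^ 7 * g) * e * θ ^ 7 * x ^ 14 := by ring
  rw [heq]
  have h1 : 0 ≤ 2 * C_A * (2 * C_s / ρ) ^ 7 := by positivity
  have hMr0 : 0 ≤ Mr := le_trans (mul_nonneg (pow_nonneg hlam 7) hg) hMr
  calc 2 * C_A * (2 * C_s / ρ) ^ 7 * (lam ^ 7 * g) * e * θ ^ 7 * x ^ 14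
      ≤ 2 * C_A * (2 * C_s / ρ) ^ 7 * Mr * e * θ ^ 7 * x ^ 14 :=
        mul_le_mul_of_nonneg_right (mul_le_mul_of_nonneg_right
          (mul_le_mul_of_nonneg_right (mul_le_mul_of_nonneg_left hMr h1) he) (pow_nonneg hθ 7)) (pow_nonneg hx0 14)
    _ ≤ 2 * C_A * (2 * C_s / ρ) ^ 7 * Mr * e * θ ^ 7 * x ^ 4 := by
        have hcoef : 0 ≤ 2 * C_A * (2 * C_s / ρ) ^ 7 * Mr * e * θ ^ 7 := by positivity
        exact mul_le_mul_of_nonneg_left hx14 hcoef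

/-- **THE HONEST TAYLOR REST IS A THEOREM UNDER THE DISPLAYED ROWS** (finite-dimensional colour space): `ChartAnalyticGΦ D Φ κ ρ C_A (gCoFam F γ)` (the slack pen's keep-`g` chart row at the birth-coupling profile),
`Deriv1VanishΦ Φ` ((32)), the HONEST configuration size row `CfgSizeΦr D B b₀ p₀ r₀ C_s` ((28) WITH its collar polylogarithm) and the `K`-UNIFORM honest window
`C_s·M(r₀,1)·λ_{n+1} θ(n) ≤ ρ/4` give `RemainderSmallΦ D (taylorRest Φ B) b₀ p₀ κ (2C_A(2C_s/ρ)⁷·M(7r₀,1))` for BOTH runs.  The honest radius `s = λ_{K-j} C_s θ(n) x²`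
is made `K`-uniform by `collarW_add_le` (`λ_{K-j} ≤ λ_{n+1} (1 + log x⁻¹)^{r₀}`, `K-j = (n+1) + (K-n-1-j)`) and `x(1 + log x⁻¹)^{r₀} ≤ M(r₀,1)`; the collar's seventh power is paid by the chart's
coupling, `λ⁷ g_b ≤ M(7r₀,1)`. [cite: Balaban1985UV3, (7) p.257, (28)–(30) p.263, (32) p.264, (57) p.270] -/
theorem remainderSmallΦ_taylorRest_honest [FiniteDimensional ℂ 𝕍] {D : AlphaDataT3 F γ} {Φ : ChartFam 𝕍 F} {B : CfgFam 𝕍 F}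
    {b₀ p₀ κ ρ C_A C_s r₀ : ℝ} (hCA : 0 ≤ C_A) (hCs : 0 ≤ C_s) (hρ : 0 < ρ) (hL : 1 ≤ F.L) (hγ : 0 < γ) (hγ1 : γ ≤ 1) (hr : 0 ≤ r₀)
    (hθ0 : ∀ n, 0 ≤ θBal F.L γ b₀ p₀ n)
    (hwin : ∀ n, C_s * logPowConst r₀ 1 * (collarW F.L γ r₀ (n + 1) * θBal F.L γ b₀ p₀ n) ≤ ρ / 4)
    (hA : ChartAnalyticGΦ D Φ κ ρ C_A (gCoFam F γ)) (h32 : Deriv1VanishΦ Φ) (hS : CfgSizeΦr D B b₀ p₀ r₀ C_s) :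
    RemainderSmallΦ D (taylorRest Φ B) b₀ p₀ κ (2 * C_A * (2 * C_s / ρ) ^ 7 * logPowConst (7 * r₀) 1) := by
  intro K n hn j hj V hV Y hY
  obtain ⟨hA0, hA1⟩ := hA.2 K (K - n) j Y hY
  obtain ⟨hS0, hS1⟩ := hS K n hn j hj V hV Y hY
  have hL' : 1 ≤ (F.L : ℝ) := by exact_mod_cast hL
  have hx0 : 0 < ((F.L : ℝ) ^ (K - n - 1 - j))⁻¹ := by positivity
  have hx1 : ((F.L : ℝ) ^ (K - n - 1 - j))⁻¹ ≤ 1 := inv_le_one_of_one_le₀ (one_le_pow₀ hL')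
  have hlam0 : 0 ≤ collarW F.L γ r₀ (K - j) := (collarW_pos hL hγ hγ1 hr _).le
  have hg0 : 0 ≤ gCo F.L γ (K - j) := (gCo_pos hL hγ _).le
  have he0 : 0 ≤ Real.exp (-κ * D.treeLen K (1 + j) Y) := (Real.exp_pos _).le
  have hcn : 0 ≤ collarW F.L γ r₀ (n + 1) := (collarW_pos hL hγ hγ1 hr (n + 1)).le
  have hs0 : 0 ≤ collarW F.L γ r₀ (K - j) *
      (C_s * θBal F.L γ b₀ p₀ n * (((F.L : ℝ) ^ (K - n - 1 - j))⁻¹) ^ 2) := by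
    have := hθ0 n; positivity
  -- the honest radius is `K`-uniformly inside the window
  have hm : K - j = (n + 1) + (K - n - 1 - j) := by omega
  have hW : collarW F.L γ r₀ (K - j) ≤
      collarW F.L γ r₀ (n + 1) * (1 + Real.log ((((F.L : ℝ) ^ (K - n - 1 - j))⁻¹)⁻¹)) ^ r₀ := by
    have := collarW_add_le hL hγ hγ1 hr (n + 1) (K - n - 1 - j)
    rw [← hm] at this
    exact this
  have hxP : ((F.L : ℝ) ^ (K - n - 1 - j))⁻¹ * (1 + Real.log ((((F.L : ℝ) ^ (K - n - 1 - j))⁻¹)⁻¹)) ^ r₀ ≤ logPowConst r₀ 1 :=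
    mul_logpow_le hx0 hx1 hr
  have hP0 : 0 ≤ (1 + Real.log ((((F.L : ℝ) ^ (K - n - 1 - j))⁻¹)⁻¹)) ^ r₀ :=
    Real.rpow_nonneg (by have := B10.log_inv_nonneg_of_le_one hx0 hx1; linarith) _
  have hsρ : collarW F.L γ r₀ (K - j) *
      (C_s * θBal F.L γ b₀ p₀ n * (((F.L : ℝ) ^ (K - n - 1 - j))⁻¹) ^ 2) ≤ ρ / 4 := by
    have h0 : 0 ≤ C_s * (collarW F.L γ r₀ (n + 1) * θBal F.L γ b₀ p₀ n) := by have := hθ0 n; positivity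
    calc collarW F.L γ r₀ (K - j) * (C_s * θBal F.L γ b₀ p₀ n * (((F.L : ℝ) ^ (K - n - 1 - j))⁻¹) ^ 2)
        ≤ collarW F.L γ r₀ (n + 1) * (1 + Real.log ((((F.L : ℝ) ^ (K - n - 1 - j))⁻¹)⁻¹)) ^ r₀ *
            (C_s * θBal F.L γ b₀ p₀ n * (((F.L : ℝ) ^ (K - n - 1 - j))⁻¹) ^ 2) :=
          mul_le_mul_of_nonneg_right hW (by have := hθ0 n; positivity)
      _ = C_s * (collarW F.L γ r₀ (n + 1) * θBal F.L γ b₀ p₀ n) * ((F.L : ℝ) ^ (K - n - 1 - j))⁻¹ *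
            (((F.L : ℝ) ^ (K - n - 1 - j))⁻¹ * (1 + Real.log ((((F.L : ℝ) ^ (K - n - 1 - j))⁻¹)⁻¹)) ^ r₀) := by ring
      _ ≤ C_s * (collarW F.L γ r₀ (n + 1) * θBal F.L γ b₀ p₀ n) * 1 * logPowConst r₀ 1 :=
          mul_le_mul (mul_le_mul_of_nonneg_left hx1 h0) hxP (mul_nonneg hx0.le hP0) (by rw [mul_one]; exact h0)
      _ = C_s * logPowConst r₀ 1 * (collarW F.L γ r₀ (n + 1) * θBal F.L γ b₀ p₀ n) := by ring
      _ ≤ ρ / 4 := hwin n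
  have hMr : collarW F.L γ r₀ (K - j) ^ 7 * gCo F.L γ (K - j) ≤ logPowConst (7 * r₀) 1 := by
    simpa using collarW_pow_mul_gCo_le' hL hγ hγ1 hr 7 (K - j)
  refine ⟨?_, ?_⟩
  · -- run `K`
    have key := abs_re_taylorRest_le hA0 (h32 K j Y) hs0 hsρ hS0
    exact key.trans (taylorRest_arith_r hCA hCs hρ he0 (hθ0 n) hx0.le hx1 hlam0 hg0 hMr)
  · -- run `K+1`: its configuration is the transport of the pull-back, whose norm the honest size row bounds
    set B₁ : PBond (F.P K) j → 𝕍 := fun c => B (K + 1) (K + 1 - n) (j + 1) (refineSet F K Y)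
      (fieldShift (F.sitesPerDir_eq (m := F.m) (K := K + 1) (j := K + 1 - n) (m' := F.m) (K' := n) (j' := 0) (by omega)) V)
      (matchBond F K j c) with hB₁
    have hpull : B (K + 1) (K + 1 - n) (j + 1) (refineSet F K Y)
        (fieldShift (F.sitesPerDir_eq (m := F.m) (K := K + 1) (j := K + 1 - n) (m' := F.m) (K' := n) (j' := 0) (by omega)) V) =
        transport 𝕍 F K j B₁ := (transport_pullback K j _).symm
    have hB' : ‖B (K + 1) (K + 1 - n) (j + 1) (refineSet F K Y)
        (fieldShift (F.sitesPerDir_eq (m := F.m) (K := K + 1) (j := K + 1 - n) (m' := F.m) (K' := n) (j' := 0) (by omega)) V)‖ ≤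
        collarW F.L γ r₀ (K - j) * (C_s * θBal F.L γ b₀ p₀ n * (((F.L : ℝ) ^ (K - n - 1 - j))⁻¹) ^ 2) := by
      rw [hpull]
      exact (norm_transport_le K j B₁).trans hS1
    have key := abs_re_taylorRest_le hA1 (h32 (K + 1) (j + 1) (refineSet F K Y)) hs0 hsρ hB'
    exact key.trans (taylorRest_arith_r hCA hCs hρ he0 (hθ0 n) hx0.le hx1 hlam0 hg0 hMr)

/-- **ALL SIX INPUT ROWS IN THE DISPLAYED (HONEST) CURRENCY GIVE THE LOCAL SLACK ROW — LOSSLESS `g`-CARRYING K1a**: for the canonical term function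
`termOfCharts Φ B Rfar`, `ChartAnalyticGΦ … (gCoFam F γ)` + `Deriv1VanishΦ` + `FlatKernelCauchyΦg` (K1a with `g`) + `CfgSizeΦr` + `CfgCauchyΦr` + the far row + the two windows
⟹ `PolymerCauchyMinAtTSlack D (termOfCharts Φ B Rfar) b₀ p₀ κ a 7 _` (σ = 7, profile `θBal(b₀,p₀)`).
[cite: Balaban1985UV3, (28)–(30) p.263, (34) p.264, (57) p.270; King1986, Prop. 3.6 (3.56) p.662, Prop. 3.9 (3.71) p.665] -/
theorem polymerCauchyMinAtTSlack_of_displayed_honest_g [FiniteDimensional ℂ 𝕍] {D : AlphaDataT3 F γ} {Φ : ChartFam 𝕍 F} {B : CfgFam 𝕍 F}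
    {Rfar : RemFam F} {b₀ p₀ κ ρ a C_A C C_s C_B C_f r₀ : ℝ}
    (hCA : 0 ≤ C_A) (hC : 0 ≤ C) (hCs : 0 ≤ C_s) (hCB : 0 ≤ C_B) (hCf : 0 ≤ C_f) (hρ : 0 < ρ) (hL : 1 ≤ F.L) (hγ : 0 < γ) (hγ1 : γ ≤ 1)
    (hr : 0 ≤ r₀) (hθ0 : ∀ n, 0 ≤ θBal F.L γ b₀ p₀ n) (hθ1 : ∀ n, (C_s + C_B) * θBal F.L γ b₀ p₀ n ≤ 1)
    (hwin : ∀ n, C_s * logPowConst r₀ 1 * (collarW F.L γ r₀ (n + 1) * θBal F.L γ b₀ p₀ n) ≤ ρ / 4)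
    (hA : ChartAnalyticGΦ D Φ κ ρ C_A (gCoFam F γ)) (h32 : Deriv1VanishΦ Φ) (hK : FlatKernelCauchyΦg D Φ κ a C)
    (hS : CfgSizeΦr D B b₀ p₀ r₀ C_s) (hBC : CfgCauchyΦr D B b₀ p₀ r₀ a C_B fun _ => 1) (hfar : RemainderSmallΦ D Rfar b₀ p₀ κ C_f) :
    PolymerCauchyMinAtTSlack D (termOfCharts Φ B Rfar) b₀ p₀ κ a 7
      (5 * (C_s ^ 2 * (C * logPowConst (6 * r₀) 1) + 6 * C_s * C_B * (C_A * (max 1 (12 / ρ)) ^ 6 * logPowConst (6 * r₀) 1)) +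
        2 * (2 * C_A * (2 * C_s / ρ) ^ 7 * logPowConst (7 * r₀) 1 + C_f)) := by
  have hM7 : 0 ≤ logPowConst (7 * r₀) 1 := (logPowConst_pos (by nlinarith) one_pos).le
  have hCE : 0 ≤ C_A * (max 1 (12 / ρ)) ^ 6 := by positivity
  have hCR : 0 ≤ 2 * C_A * (2 * C_s / ρ) ^ 7 * logPowConst (7 * r₀) 1 + C_f := by positivity
  exact polymerCauchyMinAtTSlack_of_honest_charts_g hC hCE hCR hCs hCB hL hγ hγ1 hr hθ0 hθ1
    (taylorSplit_termOfCharts Φ B Rfar) hK (kernelSizeΦg_of_chartAnalyticG hA)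
    (remainderSmallΦ_add (remainderSmallΦ_taylorRest_honest hCA hCs hρ hL hγ hγ1 hr hθ0 hwin hA h32 hS) hfar) hS hBC

/-- **ALL SIX INPUT ROWS IN THE DISPLAYED (HONEST) CURRENCY GIVE THE LOCAL SLACK ROW — VERBATIM K1a ROW OF RECORD** (no `g` in K1a; interpolation exponent
`0 < t ≤ 1`, rate `a(1-t)`): σ = 7, profile `θBal(b₀,p₀)` — the window profile of 3⁗; no letter of record re-typed.
[cite: Balaban1985UV3, (28)–(30) p.263, (34) p.264, (57) p.270; King1986, Prop. 3.6 (3.56) p.662, Prop. 3.9 (3.71) p.665] -/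
theorem polymerCauchyMinAtTSlack_of_displayed_honest [FiniteDimensional ℂ 𝕍] {D : AlphaDataT3 F γ} {Φ : ChartFam 𝕍 F} {B : CfgFam 𝕍 F}
    {Rfar : RemFam F} {b₀ p₀ κ ρ a C_A C C_s C_B C_f r₀ t : ℝ}
    (hCA : 0 ≤ C_A) (hC : 0 ≤ C) (hCs : 0 ≤ C_s) (hCB : 0 ≤ C_B) (hCf : 0 ≤ C_f) (hρ : 0 < ρ) (hL : 1 ≤ F.L) (hγ : 0 < γ) (hγ1 : γ ≤ 1)
    (hr : 0 ≤ r₀) (ha : 0 ≤ a) (ht : 0 < t) (ht1 : t ≤ 1)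
    (hθ0 : ∀ n, 0 ≤ θBal F.L γ b₀ p₀ n) (hθ1 : ∀ n, (C_s + C_B) * θBal F.L γ b₀ p₀ n ≤ 1)
    (hwin : ∀ n, C_s * logPowConst r₀ 1 * (collarW F.L γ r₀ (n + 1) * θBal F.L γ b₀ p₀ n) ≤ ρ / 4)
    (hA : ChartAnalyticGΦ D Φ κ ρ C_A (gCoFam F γ)) (h32 : Deriv1VanishΦ Φ) (hK : FlatKernelCauchyΦ D Φ κ a C)
    (hS : CfgSizeΦr D B b₀ p₀ r₀ C_s) (hBC : CfgCauchyΦr D B b₀ p₀ r₀ a C_B fun _ => 1) (hfar : RemainderSmallΦ D Rfar b₀ p₀ κ C_f) :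
    PolymerCauchyMinAtTSlack D (termOfCharts Φ B Rfar) b₀ p₀ κ (a * (1 - t)) 7
      (5 * (C_s ^ 2 * (C ^ (1 - t) * (2 * (C_A * (max 1 (12 / ρ)) ^ 6)) ^ t * logPowConst (6 * r₀) t) +
          6 * C_s * C_B * (C_A * (max 1 (12 / ρ)) ^ 6 * logPowConst (6 * r₀) 1)) +
        2 * (2 * C_A * (2 * C_s / ρ) ^ 7 * logPowConst (7 * r₀) 1 + C_f)) := by
  have hM7 : 0 ≤ logPowConst (7 * r₀) 1 := (logPowConst_pos (by nlinarith) one_pos).le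
  have hCE : 0 ≤ C_A * (max 1 (12 / ρ)) ^ 6 := by positivity
  have hCR : 0 ≤ 2 * C_A * (2 * C_s / ρ) ^ 7 * logPowConst (7 * r₀) 1 + C_f := by positivity
  exact polymerCauchyMinAtTSlack_of_honest_charts hC hCE hCR hCs hCB hL hγ hγ1 hr ha ht ht1 hθ0 hθ1
    (taylorSplit_termOfCharts Φ B Rfar) hK (kernelSizeΦg_of_chartAnalyticG hA)
    (remainderSmallΦ_add (remainderSmallΦ_taylorRest_honest hCA hCs hρ hL hγ hγ1 hr hθ0 hwin hA h32 hS) hfar) hS hBC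

end Displayed

/-! ## §6 The honest K1a line implies the K1a line of record (rate `a(1-t)`), hence the registered text of 3⁗ — by name -/

section HonestLine

/-- **THE HONEST K1a LINE FOR ONE CONSTANTS RECORD** (hypothesis schema, never asserted): the slack pen's `K1aLine L 𝔠 a₀ a₁ a` (p532839 §3) with its three
display-located rows read in the DISPLAYED currency — the kernel size row WITH the birth coupling and both runs (`KernelSizeΦg`), the configuration rows WITH
print's collar polylogarithm `r(g_b) = (1 + log g_b⁻¹)^{r₀}` of (7)/(28) at the record's exponent `𝔠.r₀` (`CfgSizeΦr`, `CfgCauchyΦr`); the other eight rows, the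
window and the coherent package VERBATIM. [cite: Balaban1985UV3, (7) p.257, (28) p.263, (34) p.264; King1986, Thm 3.4 (3.9) p.656, Prop. 3.6 p.662] -/
def K1aLineHonest (L : ℕ) (𝔠 : AlphaConsts L (suGroupModel 2).N) (a₀ a₁ a : ℝ) : Prop :=
  ∃ (κ C C_E C_R C_s C_B C_T C' γB : ℝ), 0 ≤ C ∧ 0 ≤ C_E ∧ 0 ≤ C_R ∧ 0 ≤ C_s ∧ 0 ≤ C_B ∧ 0 ≤ C_T ∧ 0 < γB ∧
    ∀ (F : T3Family) (γ : ℝ) (hF : F.L = L) (hγ : 0 < γ), γ ≤ γB → ∀ (hγ1 : γ ≤ (min (hF ▸ 𝔠).gamma0 1) ^ 2),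
      AlphaInputsT3AC.OfV3At F (hF ▸ 𝔠) a₀ a₁ →
        (∀ n, (C_s + C_B) * θBal F.L γ (hF ▸ 𝔠).b₀ (hF ▸ 𝔠).p₀ n ≤ 1) ∧
        ∃ (p : ∀ K, AlphaInputsT3AC.PkgAtV3 F (hF ▸ 𝔠) γ hγ hγ1 K), (∀ K, (p K).a₀ = a₀ ∧ (p K).a₁ = a₁) ∧
          ∃ (π : AlphaInputsT3AC.PolymerT3 F) (PT : TermFn F) (Φ : ChartFam ↥(lieC (suGroupModel 2)) F) (e : VacFam F)
            (B : CfgFam ↥(lieC (suGroupModel 2)) F) (R : RemFam F),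
            PintDecompTrivT (AlphaInputsT3AC.dataOfV3 p π) PT ∧ LocCover (AlphaInputsT3AC.dataOfV3 p π) κ C' ∧
            LocBlockVolume (AlphaInputsT3AC.dataOfV3 p π) ∧ LocMatched (AlphaInputsT3AC.dataOfV3 p π) ∧
            TermSizeTrivT (AlphaInputsT3AC.dataOfV3 p π) PT (hF ▸ 𝔠).b₀ (hF ▸ 𝔠).p₀ C_T κ ∧
            TaylorSplitΦ PT Φ e B R ∧ FlatKernelCauchyΦ (AlphaInputsT3AC.dataOfV3 p π) Φ κ a C ∧
            KernelSizeΦg (AlphaInputsT3AC.dataOfV3 p π) Φ κ C_E ∧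
            RemainderSmallΦ (AlphaInputsT3AC.dataOfV3 p π) R (hF ▸ 𝔠).b₀ (hF ▸ 𝔠).p₀ κ C_R ∧
            CfgSizeΦr (AlphaInputsT3AC.dataOfV3 p π) B (hF ▸ 𝔠).b₀ (hF ▸ 𝔠).p₀ (hF ▸ 𝔠).r₀ C_s ∧
            CfgCauchyΦr (AlphaInputsT3AC.dataOfV3 p π) B (hF ▸ 𝔠).b₀ (hF ▸ 𝔠).p₀ (hF ▸ 𝔠).r₀ a C_B fun _ => 1

/-- **THE HONEST LINE IMPLIES THE LINE OF RECORD** at rate `a(1-t)` (any `0 < t ≤ 1`): witness the record's chart family and configurations by the RESCALED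
pair `(Φ̃, B̃) = (Φ∘(λ•), λ⁻¹•B)`, `λ = r(g_b)` at the record's `r₀`; constants `C ↦ C^{1-t}(2C_E)^t·M(6r₀,t)`, `C_E ↦ C_E·M(6r₀,1)`, everything else verbatim.
[cite: Balaban1985UV3, (7) p.257, (28) p.263, (34) p.264; King1986, Prop. 3.6 (3.56) p.662, Prop. 3.9 (3.71) p.665] -/
theorem k1aLine_of_honest {L : ℕ} {𝔠 : AlphaConsts L (suGroupModel 2).N} {a₀ a₁ a t : ℝ} (ha : 0 ≤ a) (ht : 0 < t) (ht1 : t ≤ 1)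
    (h : K1aLineHonest L 𝔠 a₀ a₁ a) : K1aLine L 𝔠 a₀ a₁ (a * (1 - t)) := by
  obtain ⟨κ, C, C_E, C_R, C_s, C_B, C_T, C', γB, hC, hCE, hCR, hCs, hCB, hCT, hγB, hline⟩ := h
  have hr : 0 ≤ 𝔠.r₀ := le_trans zero_le_one 𝔠.one_le_r₀
  have hM1 : 0 ≤ logPowConst (6 * 𝔠.r₀) 1 := (logPowConst_pos (by nlinarith) one_pos).le
  have hMt : 0 ≤ logPowConst (6 * 𝔠.r₀) t := (logPowConst_pos (by nlinarith) ht).le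
  refine ⟨κ, C ^ (1 - t) * (2 * C_E) ^ t * logPowConst (6 * 𝔠.r₀) t, C_E * logPowConst (6 * 𝔠.r₀) 1, C_R, C_s, C_B, C_T, C', γB,
    mul_nonneg (mul_nonneg (Real.rpow_nonneg hC _) (Real.rpow_nonneg (by linarith) _)) hMt, mul_nonneg hCE hM1, hCR, hCs, hCB, hCT, hγB,
    fun F γ hF hγ hγle hγ1 hOf => ?_⟩
  subst hF
  obtain ⟨hwin, p, hp, π, PT, Φ, e, B, R, hdec, hLC, hBV, hLM, hTS, hT, hK, hE, hR, hS, hBC⟩ := hline F γ rfl hγ hγle hγ1 hOf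
  have hL : 1 ≤ F.L := F.hL.2.le
  have hγ1' : γ ≤ 1 := hγ1.trans (sq_min_one_le _ 𝔠.gamma0_pos)
  have hθ0 : ∀ n, 0 ≤ θBal F.L γ 𝔠.b₀ 𝔠.p₀ n := fun n =>
    (T3MinimiserStabilityReduction.θBal_pos hL hγ hγ1' 𝔠.b₀_pos 𝔠.p₀ n).le
  have hw0 : ∀ i, collarW F.L γ 𝔠.r₀ i ≠ 0 := fun i => (collarW_pos hL hγ hγ1' hr i).ne'
  have ha' : a * (1 - t) ≤ a := by nlinarith
  exact ⟨hwin, p, hp, π, PT, rescaleΦ (collarW F.L γ 𝔠.r₀) Φ, e, rescaleB (collarW F.L γ 𝔠.r₀) B, R, hdec, hLC, hBV, hLM, hTS,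
    taylorSplitΦ_rescale _ hw0 hT, flatKernelCauchyΦ_rescale hL hγ hγ1' hr hC hCE ht ht1 hK hE, kernelSizeΦ_rescale hL hγ hγ1' hr hCE hE, hR,
    cfgSizeΦ_rescale hL hγ hγ1' hr hS, cfgCauchyΦ_rate_mono hL hCB hθ0 (fun _ => zero_le_one) ha' (cfgCauchyΦ_rescale hL hγ hγ1' hr hBC)⟩

/-- **THE REGISTERED TEXT OF 3⁗ FROM THE HONEST K1a LINE, BY NAME** (`globalTwoRunSlackFam_of_k1aLine ∘ k1aLine_of_honest` at `t = ½`): if for every odd `L ≥ 7`,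
every constants record and [7]-constants there is a rate exponent `0 < a < 1` with `K1aLineHonest L 𝔠 a₀ a₁ a`, then the text of `stub_globalTwoRunSlackFam`
(skeleton v5j‴ `Cruxes/FluctuationComparisonRegPrL/Lines/birth_v5j3.lean` l.107–119) holds VERBATIM — σ = 7, profile `θBal(b₀,p₀)`, rate `a/2`; no letter of
record re-typed, no «r₀ letter», no profile letter, no β-door. [cite: King1986, Thm 3.4 (3.9) p.656, Prop. 3.6 p.662; Balaban1985UV3, (7) p.257, (28) p.263,
(34) p.264, (43)-(46) pp.266-267, (57) p.270] -/
theorem globalTwoRunSlackFam_of_k1aLineHonest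
    (h : ∀ (L : ℕ), Odd L → 7 ≤ L → ∀ (𝔠 : AlphaConsts L (suGroupModel 2).N) (a₀ a₁ : ℝ), 0 < a₀ → 0 < a₁ → 𝔠.B₃ * a₁ ≤ a₀ →
      ∃ a : ℝ, 0 < a ∧ a < 1 ∧ K1aLineHonest L 𝔠 a₀ a₁ a) :
    ∀ (L : ℕ), Odd L → 7 ≤ L → ∀ (𝔠 : Summit.QuantumFields.Balaban3D.Proofs.Primitives.AlphaConsts L (Summit.QuantumFields.Balaban3D.Carriers.suGroupModel 2).N)
      (a₀ a₁ : ℝ), 0 < a₀ → 0 < a₁ → 𝔠.B₃ * a₁ ≤ a₀ →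
      ∃ a : ℝ, 0 < a ∧ ∃ γB : ℝ, 0 < γB ∧ ∀ (F : T3Family) (γ : ℝ) (hF : F.L = L) (hγ : 0 < γ), γ ≤ γB →
        ∀ (hγ1 : γ ≤ (min (hF ▸ 𝔠).gamma0 1) ^ 2),
          Summit.QuantumFields.YangMills.Theorems.AlphaInputsT3AC.OfV3At F (hF ▸ 𝔠) a₀ a₁ →
          ∃ (p : ∀ K, Summit.QuantumFields.YangMills.Theorems.AlphaInputsT3AC.PkgAtV3 F (hF ▸ 𝔠) γ hγ hγ1 K),
            (∀ K, (p K).a₀ = a₀ ∧ (p K).a₁ = a₁) ∧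
            ∃ (π : Summit.QuantumFields.YangMills.Theorems.AlphaInputsT3AC.PolymerT3 F) (σ : ℕ) (C : ℝ), 7 ≤ σ ∧ 0 ≤ C ∧
              Summit.QuantumFields.YangMills.Theorems.GlobalSlack.GlobalSupRateTSlack (Summit.QuantumFields.YangMills.Theorems.AlphaInputsT3AC.dataOfV3 p π) (hF ▸ 𝔠).b₀ (hF ▸ 𝔠).p₀ a σ C :=
  globalTwoRunSlackFam_of_k1aLine fun L hLo h7 𝔠 a₀ a₁ ha0 ha1 hw => by
    obtain ⟨a, ha, ha1', hH⟩ := h L hLo h7 𝔠 a₀ a₁ ha0 ha1 hw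
    exact ⟨a * (1 - 1 / 2), by nlinarith, by nlinarith, k1aLine_of_honest ha.le one_half_pos (by norm_num) hH⟩

end HonestLine

end Summit.QuantumFields.YangMills.Cruxes.FluctuationComparisonRegPr.Ideate1CollarPolylog

end
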